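import Literature.ComputerArithmetic.RumpOgitaOishi2008.ExtractVector
import Literature.ComputerArithmetic.LangeRump2018.Proposition14
import Literature.ComputerArithmetic.BoldoJeannerodMelquiondMuller2023.DirectedRoundings
import Literature.ComputerArithmetic.BoldoJeannerodMelquiondMuller2023.CorrectRoundingHalfUlp

/-!
# Rump–Ogita–Oishi 2008: faithful rounding (Definition 2.3, Lemma 2.4), the second inequality of
# (2.20), and the faithfully rounded summation `AccSum` (Algorithms 4.1 / 4.5, Lemmas 4.2–4.3,
# Proposition 4.6, Corollary 4.7)

HONEST FRAMING (ENGINES group, unit `eng-quad-4`, kernels lane of the `certquad` engine — shared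
numerical engines serving client cells; rigour lives in the verifiers; every published number
belongs to a client cell's ledger, not to the engines group): the lane's anchor `ExtractVector` typed and
proved, at FORMAT LEVEL — over the tree's binary floating-point numbers `JeannerodRump2018.IsFloat p emin`
(precision `p`, gradual underflow from `emin`, NO overflow) and ANY round-to-nearest map
`JeannerodRump2018.IsRoundNearest p emin fl` (no tie rule fixed) — the `ufp` toolkit of §2 and the
error-free transformation `ExtractVector` of §3 of the source. This file carries the analysis of Part I to
its main result in the same model: the spacing of `F` around a float (Lemma 2.2, eqs. (2.23)–(2.24)),
FAITHFUL ROUNDING (Definition 2.3) and the criterion Lemma 2.4, the second inequality of (2.20) in any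
order, and §4 — Algorithm 4.1 `Transform` with its invariant Lemma 4.2, Lemma 4.3, Algorithm 4.5 `AccSum`,
PROPOSITION 4.6 (`AccSum` computes a faithful rounding of `Σ pᵢ`) and Corollary 4.7 — all PROVED. No
hardware, vendor, timing, flop-count or IEEE-format claims: `p` and `emin` are parameters (the source's
`2²ᴹeps ≤ 1` becomes `2·⌈log₂(n + 2)⌉ ≤ p`).

Source read at the page: [RumpOgitaOishi2008] S. M. Rump, T. Ogita, S. Oishi, *Accurate floating-point
summation part I: faithful rounding*, SIAM J. Sci. Comput. 31(1) (2008) 189–224,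
doi:10.1137/050645671; read in the authors' version (33 pp.; its page numbers are used): p. 4 (`F`, `U`,
`eps`, `eta`), p. 6 (eq. (2.20) and its proof, (2.21)–(2.22)), p. 7 (Lemma 2.2 with proof, eqs.
(2.23)–(2.24), Definition 2.3, eq. (2.25)), p. 8 (Lemma 2.4 with proof, eq. (2.26),
Algorithm 2.5), p. 15 (Algorithm 4.1 `Transform`, Remarks 1–2, eq. (4.1), Lemma 4.2, eqs. (4.2)–(4.5)),
pp. 16–17 (Remarks, proof of Lemma 4.2, eqs. (4.6)–(4.7)), p. 17 (Lemma 4.3, eqs. (4.8)–(4.12), Remarks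
1–2), p. 18 (Table 4.1, Remarks 3–5), pp. 18–20 (proof of Lemma 4.3, eqs. (4.13)–(4.23), Fig. 4.1),
p. 21 (Algorithm 4.4, Algorithm 4.5 `AccSum`, Proposition 4.6 with proof), p. 22 (Corollary 4.7, eq. (4.24), with proof, Remarks 1–2, Theorem 4.8).

DICTIONARY (source ↦ here; carriers `ℚ`; the dictionary of `ExtractVector` — `F`, `fl`, `eps ↦
unitRoundoff p = 2^-p`, `eta ↦ 2^emin`, `½eps⁻¹eta ↦ 2^(emin+p-1)`, `ufp`, `gℤ ↦ OnGrid g`, `σ = 2^k`,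
`FastTwoSum ↦ fast2Sum`, `ExtractVector ↦ extractVector`, "in any order" ↦ `SumTree.eval` — continues).
* `f ∈ U` ↦ `|f| ≤ 2^(emin+p-1)`; `f ∉ U` ↦ `2^(emin+p-1) < |f|`.
* `pred(f) = max{g ∈ F : g < f}`, `succ(f)` ↦ the predicates `IsPred p emin f g`, `IsSucc p emin f g`
  (unique, `IsPred.unique`; they exist for `p ≥ 1`, `exists_isPred` / `exists_isSucc`, `F` being
  discrete and unbounded).
* "`f ∈ F` is a faithful rounding of `r ∈ ℝ`", `pred(f) < r < succ(f)` (2.25), `f ∈ □(r)` ↦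
  `IsFaithfulRounding p emin f r`, typed in the quantifier form "`f ∈ F`, every float below `f` is below
  `r`, every float above `f` is above `r`"; `isFaithfulRounding_iff_pred_lt_lt_succ` is (2.25) literally
  and `isFaithfulRounding_iff_isFaithful` identifies it with the tree's
  `BoldoJeannerodMelquiondMuller2023.IsFaithful p emin r f` (`f = RD(r)` or `f = RU(r)`).
* Algorithm 4.1: the input vector `p⁽⁰⁾` ↦ `xs : List ℚ` (`p` is the precision here), `n = length(p⁽⁰⁾)`;
  `μ = max |pᵢ|` ↦ `maxAbs xs`; `M = ⌈log₂(n + 2)⌉` ↦ `Nat.clog 2 (xs.length + 2)`; `⌈log₂ μ⌉` ↦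
  `Int.clog 2 μ`; `σ₀ = 2^(M + ⌈log₂ μ⌉)`; `2ᴹepsσ`, `2²ᴹepsσ` ↦ `2^M * unitRoundoff p * σ`,
  `2^(2*M) * unitRoundoff p * σ` (`= 2^(k+M-p)`, `2^(k+2M-p)`: `two_pow_mul_u_mul_two_zpow`); the
  "repeat–until" loop ↦ `transformAux fl M eps (½eps⁻¹eta) fuel t σ p`, structural recursion on a fuel
  argument with the loop state `(t⁽ᵐ⁻¹⁾, σₘ₋₁, p⁽ᵐ⁻¹⁾)` (Lemma 4.2 bounds the number of passes: `σ`
  drops by the factor `2ᴹeps ≤ 2^-M` per pass and the loop exits once `σₘ₋₁ ≤ ½eps⁻¹eta`, so the fuel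
  `M + ⌈log₂ μ⌉ - emin + 1` supplied by `transform` is never exhausted — `transformAux_spec` proves the
  postcondition for every sufficient fuel); `Transform(p⁽⁰⁾) = [τ₁, τ₂, p⁽ᵐ⁾, σ]` ↦
  `transform fl p emin xs : ℚ × ℚ × List ℚ × ℚ`; the format constants `eps`, `realmin` of the source's
  Matlab code ↦ the arguments `p`, `emin`.
* Lemma 4.2's assertions (4.2)–(4.5) on `[τ₁, τ₂, p⁽ᵐ⁾, σ]` (with the last pass's `t⁽ᵐ⁻¹⁾`, `τ⁽ᵐ⁾`
  existentially quantified) ↦ `TransformSpec p emin fl M s n τ₁ τ₂ p⁽ᵐ⁾ σ`.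
* Algorithm 4.5: `fl(Σ p′ᵢ)` ↦ `flSum fl p′` (recursive summation from the left; ANY order is covered by
  `faithful_of_transformSpec_tree`); `AccSum(p)` ↦ `accSum fl p emin xs = fl(τ₁ + fl(τ₂ + flSum p⁽ᵐ⁾))`.

Typed and PROVED (all sorry-free; `[cite: …]` locators on every declaration):

* LEMMA 2.2 / eqs. (2.23)–(2.24), the parts used later — `u_mul_abs_le_abs_sub` (`f ≠ g ∈ F ⟹
  |g − f| ≥ eps|f|`, via the tree's `abs_le_sub_of_abs_lt_two_zpow`: `|g| < 2^E ⟹ |g| ≤ 2^E − eps2^E`),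
  `u_mul_ufp_le_abs_sub`, `le_sub_eta_of_lt`; (2.23) `IsPred.le_sub` / `IsSucc.add_le` (`pred(f) ≤ f − eps·ufp(f)`,
  `f + eps·ufp(f) ≤ succ(f)`, and with `eps|f|`); `isPred_sub_eta_and_isSucc_add_eta` (`f ∈ U ⟹ pred,
  succ = f ∓ eta`); `isFloat_add_two_u_ufp_of_not_mem_U` (`f ∉ U ⟹ f ± 2eps·ufp(f) ∈ F`); (2.24)
  `pred_succ_within_two_u_ufp`.
* DEFINITION 2.3 — `IsFaithfulRounding`, `isFaithfulRounding_iff_pred_lt_lt_succ` (2.25),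
  `isFaithfulRounding_iff_isFaithful`, `IsFaithfulRounding.eq_of_isFloat` (`r ∈ F ⟹ f = r`),
  `isFaithfulRounding_fl` (rounding to nearest is faithful), (2.26) `IsFaithfulRounding.le_of_le` /
  `le_of_ge`, `IsFaithfulRounding.sign`.
* LEMMA 2.4 — `isFaithfulRounding_fl_of_not_mem_U` (`r̃ = fl(r) ∉ U`, `2|δ| < eps|r̃| ⟹ r̃ ∈ □(r + δ)`),
  `isFaithfulRounding_fl_of_mem_U` (`r̃ ∈ U`, `|δ| < ½eta`), joined as `isFaithfulRounding_fl_add`; with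
  `abs_fl_sub_le_half_eta` (`r̃ ∈ U ⟹ |r̃ − r| ≤ ½eta`).
* EQ. (2.20), second inequality, in ANY order — `abs_eval_sub_exact_le` (`|fl(Σaᵢ) − Σaᵢ| ≤
  ½n(n−1)eps·2ʲ` for `n ≤ 2^p = eps⁻¹` floats `|aᵢ| ≤ 2ʲ`, `2ʲ ≥ eta`), via `ufp_le_pred_mul_two_zpow`.
* ALGORITHM 4.1 / 4.5 — `maxAbs` (+ `maxAbs_eq_zero_iff`, `exists_abs_eq_maxAbs`), `transformAux`,
  `transform`, `transform_of_maxAbs_eq_zero`, `flSum` (`flSum_cons_eq_eval`, `exists_tree_flSum`), `accSum`.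
* LEMMA 4.2 — `TransformSpec`; `transformAux_spec` (the loop: invariant (4.2)–(4.3), exactness of
  `t⁽ᵐ⁾ = fl(t⁽ᵐ⁻¹⁾ + τ⁽ᵐ⁾)` while the loop continues, Lemma 2.6 at the exit, (4.4)–(4.5));
  `transform_spec` (Lemma 4.2 for Algorithm 4.1 on a nonzero vector); `TransformSpec.eqs` ((4.9), (4.10),
  (4.12) of Lemma 4.3).
* LEMMA 4.3 — `faithful_of_transformSpec` (the proof (4.13)–(4.23) over the assertions of Lemma 4.2 and
  an abstract `τ₃ = fl(Σ p′ᵢ)` obeying (4.15)/(2.20)), `faithful_of_transformSpec_tree` (`Σ p′ᵢ` in any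
  order), `accSum_spec_of_maxAbs_ne_zero` (for `AccSum`: faithful, the `res = 0` clause (4.23), and
  (4.11)), `abs_sum_sub_accSum_lt` ((4.11): `res ≠ 0 ⟹ |s − res| < 2eps(1 − 2^(−M−1))ufp(res)`).
* PROPOSITION 4.6 — `isFaithfulRounding_accSum` (`p ⊆ F`, `2⌈log₂(n+2)⌉ ≤ p ⟹ AccSum(p) ∈ □(Σ pᵢ)`;
  the zero and the empty vector included), `isFaithful_accSum` (the same in the tree's `IsFaithful`).
* COROLLARY 4.7 — (4.24) `accSum_eq_sum_of_isFloat_sum` (`s ∈ F ⟹ res = s`) and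
  `accSum_eq_sum_of_abs_le` (`res ∈ U ⟹ res = s`); `accSum_eq_zero_iff` (`res = 0 ⟺ s = 0`);
  `accSum_pos_iff_and_neg_iff` (`sign(res) = sign(s)`).

NOTES. (a) HYPOTHESES AND TIE RULE. Everything here holds for EVERY round-to-nearest `fl` (no tie rule),
with `p` and `emin` free, under the source's standing assumption `2²ᴹeps ≤ 1` (`2 * Nat.clog 2 (n + 2) ≤ p`,
which forces `M ≥ 2`, `p ≥ 4` for a nonempty vector); `ExtractVector`'s NOTE (a) (two clauses of Lemma 3.3 /
Theorem 3.5 need ties-to-even when `2ᴹeps ≥ 1`) is not met with, `M < p` throughout. The strictness of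
(4.21) is obtained from `n ≥ 1` (`n·epsσ > 0`).
(b) FUEL. The source's loop is a `repeat–until`; it is typed by structural recursion on an explicit pass
budget (returning the current state unchanged when the budget is `0`), and Lemma 4.2 (`transformAux_spec`,
hypothesis `k − emin < fuel` for `σ = 2^k`) shows the budget chosen by `transform` is never exhausted, so
`transform` IS Algorithm 4.1 on every input (for the zero vector both return `τ₁ = τ₂ = σ = 0`, `p` unchanged).
(c) (4.11) is stated for `res ≠ 0`; for `res = 0` Lemma 4.3 / Corollary 4.7 give `s = 0 = res` exactly,
while the printed strict inequality would read `0 < 0`.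
(d) NOT typed here: Algorithm 4.4 (the final `Transform` with the extra "check for zero" exit `t⁽ᵐ⁾ = 0 ⟹
restart with `ExtractVector(σₘ, p⁽ᵐ⁾)` — an optimisation for `s = 0`; Algorithm 4.5 with Algorithm 4.1
computes the same kind of result, and Proposition 4.6 is proved here for that combination), Algorithm 3.6 /
Theorem 3.7 (`NextPowerTwo`; `M` and `σ₀` are computed with `Nat.clog` / `Int.clog`, as the source does
"for clarity", Remark 2 after Algorithm 4.1), Table 4.1 and the optimality Remarks, Theorem 4.8 (the
number of passes in terms of the condition number), §5 (computational results), §6 (the Matlab code), the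
remaining cases of Lemma 2.2, and Part II.
-/

namespace Literature.ComputerArithmetic.RumpOgitaOishi2008

open Literature.ComputerArithmetic.JeannerodRump2018
open Literature.ComputerArithmetic.JeannerodRump2018.SumTree
open Literature.ComputerArithmetic.BoldoJeannerodMelquiondMuller2023
-- landed engine lemmas reused by name (`2^k ∈ F`, `|f| ≥ eta` for `f ∈ F \ {0}`, `|Σ| ≤ Σ|·|`, `Σ leaves`):
open Literature.ComputerArithmetic.JoldesMullerPopescu2017 (isFloat_two_zpow two_zpow_emin_le_abs)
open Literature.ComputerArithmetic.LangeRump2018 (abs_list_sum_le exact_eq_leaves_sum)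

variable {p : ℕ} {emin : ℤ} {fl : ℚ → ℚ}

/-! ### §2, Lemma 2.2 and eqs. (2.23)–(2.24): the spacing of `F` around a float -/

/-- `eps ≤ 1` (indeed `eps = 2^-p ≤ ½` for `p ≥ 1`). [cite: RumpOgitaOishi2008, §2 (p. 192, eps)] -/
theorem u_le_one : unitRoundoff p ≤ 1 := by
  rw [unitRoundoff, div_le_one (by positivity)]
  exact one_le_pow₀ (by norm_num)

/-- Eq. (2.23), magnitude form, the spacing fact behind Lemma 2.2: two DISTINCT floats `f ≠ g` satisfy
`|g − f| ≥ eps·|f|` (in the binade of `f` and above, floats lie on the grid `2eps·ufp(f)ℤ` and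
`2eps·ufp(f) > eps|f|`; below it, `|g| ≤ pred(ufp(f)) ≤ ufp(f) − eps·ufp(f)`).
[cite: RumpOgitaOishi2008, Lemma 2.2 / eq. (2.23)] -/
theorem u_mul_abs_le_abs_sub (hp : 1 ≤ p) {f g : ℚ} (hf : IsFloat p emin f) (hg : IsFloat p emin g)
    (hne : g ≠ f) : unitRoundoff p * |f| ≤ |g - f| := by
  by_cases hf0 : f = 0
  · subst hf0; simp
  set E : ℤ := Int.log 2 |f| with hE
  have hEf : (2 : ℚ) ^ E ≤ |f| := zpow_log_le_abs hf0
  have hfE : |f| < (2 : ℚ) ^ (E + 1) := by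
    have := Int.lt_zpow_succ_log_self (by norm_num : 1 < 2) |f|
    exact_mod_cast this
  rcases le_or_gt ((2 : ℚ) ^ E) |g| with hge | hlt
  · -- the binade of `f` or above: both lie on the grid `2^(E-p+1)ℤ = 2eps·ufp(f)ℤ`
    have hd : OnGrid ((2 : ℚ) ^ (E - p + 1)) (g - f) :=
      (onGrid_of_isFloat_of_le_abs hg hge).sub (onGrid_of_isFloat_of_le_abs hf hEf)
    have h1 := two_zpow_le_abs_of_onGrid hd (sub_ne_zero.mpr hne)
    have h2 : unitRoundoff p * |f| < (2 : ℚ) ^ (E - p + 1) := by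
      rw [show (E - p + 1 : ℤ) = (E + 1) - p by ring, ← u_mul_two_zpow]
      exact mul_lt_mul_of_pos_left hfE u_pos
    linarith
  · -- `|g| < ufp(f)`: `|g| ≤ ufp(f) − eps·ufp(f)`
    have hg' := abs_le_sub_of_abs_lt_two_zpow hp hg hlt
    have h1 : |f| - |g| ≤ |g - f| := by
      have := abs_sub_abs_le_abs_sub f g; rwa [abs_sub_comm] at this
    have h2 : unitRoundoff p * (|f| - (2 : ℚ) ^ E) ≤ |f| - (2 : ℚ) ^ E :=
      mul_le_of_le_one_left (sub_nonneg.mpr hEf) u_le_one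
    have h3 : unitRoundoff p * (2 : ℚ) ^ E = (2 : ℚ) ^ (E - p) := u_mul_two_zpow E
    nlinarith

/-- Eq. (2.23) with `ufp`: distinct floats `f ≠ g` satisfy `|g − f| ≥ eps·ufp(f)`, i.e.
`pred(f) ≤ f − eps·ufp(f)` and `f + eps·ufp(f) ≤ succ(f)`. [cite: RumpOgitaOishi2008, eq. (2.23)] -/
theorem u_mul_ufp_le_abs_sub (hp : 1 ≤ p) {f g : ℚ} (hf : IsFloat p emin f) (hg : IsFloat p emin g)
    (hne : g ≠ f) : unitRoundoff p * ufp f ≤ |g - f| :=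
  (u_mul_ufp_le_u_mul_abs f).trans (u_mul_abs_le_abs_sub hp hf hg hne)

/-- `F ⊆ etaℤ`, so floats `g < f` satisfy `g ≤ f − eta`: in the underflow range `U` neighbours are
exactly `eta` apart (Lemma 2.2, case `f ∈ U`). [cite: RumpOgitaOishi2008, Lemma 2.2 (case f ∈ U)] -/
theorem le_sub_eta_of_lt {f g : ℚ} (hf : IsFloat p emin f) (hg : IsFloat p emin g) (h : g < f) :
    g ≤ f - (2 : ℚ) ^ emin := by
  obtain ⟨Nf, hNf⟩ := hf.exists_int_mul_zpow_emin
  obtain ⟨Ng, hNg⟩ := hg.exists_int_mul_zpow_emin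
  have h2 := two_zpow_pos emin
  rw [hNf, hNg] at h ⊢
  have hlt : (Ng : ℚ) < Nf := lt_of_mul_lt_mul_right h h2.le
  have hle : Ng + 1 ≤ Nf := by exact_mod_cast hlt
  have : ((Ng : ℚ) + 1) * (2 : ℚ) ^ emin ≤ (Nf : ℚ) * (2 : ℚ) ^ emin :=
    mul_le_mul_of_nonneg_right (by exact_mod_cast hle) h2.le
  linarith

/-- "pred(f) := max{g ∈ F : g < f}" as a predicate: `IsPred p emin f g` says `g` is that maximum.
[cite: RumpOgitaOishi2008, §2 (p. 195, pred and succ)] -/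
def IsPred (p : ℕ) (emin : ℤ) (f g : ℚ) : Prop :=
  IsFloat p emin g ∧ g < f ∧ ∀ h : ℚ, IsFloat p emin h → h < f → h ≤ g

/-- "succ(f) := min{g ∈ F : f < g}" as a predicate: `IsSucc p emin f g` says `g` is that minimum.
[cite: RumpOgitaOishi2008, §2 (p. 195, pred and succ)] -/
def IsSucc (p : ℕ) (emin : ℤ) (f g : ℚ) : Prop :=
  IsFloat p emin g ∧ f < g ∧ ∀ h : ℚ, IsFloat p emin h → f < h → g ≤ h

/-- `pred(f)` is unique. [cite: RumpOgitaOishi2008, §2 (p. 195, pred)] -/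
theorem IsPred.unique {f g g' : ℚ} (h : IsPred p emin f g) (h' : IsPred p emin f g') : g = g' :=
  le_antisymm (h'.2.2 g h.1 h.2.1) (h.2.2 g' h'.1 h'.2.1)

/-- `succ(f)` is unique. [cite: RumpOgitaOishi2008, §2 (p. 195, succ)] -/
theorem IsSucc.unique {f g g' : ℚ} (h : IsSucc p emin f g) (h' : IsSucc p emin f g') : g = g' :=
  le_antisymm (h.2.2 g' h'.1 h'.2.1) (h'.2.2 g h.1 h.2.1)

/-- `pred(f)` exists for `f ∈ F` (no smallest float in this overflow-free, two-sided model): it is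
`RD(f − eta)`, every float below `f` being `≤ f − eta`. [cite: RumpOgitaOishi2008, §2 (p. 195, pred)] -/
theorem exists_isPred (hp : 1 ≤ p) {f : ℚ} (hf : IsFloat p emin f) : ∃ g, IsPred p emin f g := by
  obtain ⟨g, hgF, hgle, hgmax⟩ := exists_isRD (emin := emin) hp (f - (2 : ℚ) ^ emin)
  refine ⟨g, hgF, ?_, fun h hh hhf => hgmax h hh (le_sub_eta_of_lt hf hh hhf)⟩
  have := two_zpow_pos emin
  linarith

/-- `succ(f)` exists for `f ∈ F`: it is `RU(f + eta)`. [cite: RumpOgitaOishi2008, §2 (p. 195, succ)] -/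
theorem exists_isSucc (hp : 1 ≤ p) {f : ℚ} (hf : IsFloat p emin f) : ∃ g, IsSucc p emin f g := by
  obtain ⟨g, hgF, hgge, hgmin⟩ := exists_isRU (emin := emin) hp (f + (2 : ℚ) ^ emin)
  refine ⟨g, hgF, ?_, fun h hh hfh => hgmin h hh ?_⟩
  · have := two_zpow_pos emin
    linarith
  · have := le_sub_eta_of_lt hh hf hfh
    linarith

/-- Eq. (2.23), left: `pred(f) ≤ f − eps·|f| ≤ f − eps·ufp(f)` for `f ∈ F`.
[cite: RumpOgitaOishi2008, eq. (2.23)] -/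
theorem IsPred.le_sub (hp : 1 ≤ p) {f g : ℚ} (hf : IsFloat p emin f) (h : IsPred p emin f g) :
    g ≤ f - unitRoundoff p * |f| ∧ g ≤ f - unitRoundoff p * ufp f := by
  have h1 := u_mul_abs_le_abs_sub hp hf h.1 h.2.1.ne
  rw [abs_sub_comm, abs_of_pos (sub_pos.mpr h.2.1)] at h1
  have h2 := u_mul_ufp_le_u_mul_abs (p := p) f
  exact ⟨by linarith, by linarith⟩

/-- Eq. (2.23), right: `f + eps·ufp(f) ≤ f + eps·|f| ≤ succ(f)` for `f ∈ F`.
[cite: RumpOgitaOishi2008, eq. (2.23)] -/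
theorem IsSucc.add_le (hp : 1 ≤ p) {f g : ℚ} (hf : IsFloat p emin f) (h : IsSucc p emin f g) :
    f + unitRoundoff p * |f| ≤ g ∧ f + unitRoundoff p * ufp f ≤ g := by
  have h1 := u_mul_abs_le_abs_sub hp hf h.1 h.2.1.ne'
  rw [abs_of_pos (sub_pos.mpr h.2.1)] at h1
  have h2 := u_mul_ufp_le_u_mul_abs (p := p) f
  exact ⟨by linarith, by linarith⟩

/-- LEMMA 2.2, case `f ∈ U`: `f ∈ F`, `|f| ≤ ½eps⁻¹eta` ⟹ `pred(f) = f − eta` and `succ(f) = f + eta`.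
[cite: RumpOgitaOishi2008, Lemma 2.2 (case f ∈ U)] -/
theorem isPred_sub_eta_and_isSucc_add_eta (hp : 1 ≤ p) {f : ℚ} (hf : IsFloat p emin f)
    (hU : |f| ≤ (2 : ℚ) ^ (emin + p - 1)) :
    IsPred p emin f (f - (2 : ℚ) ^ emin) ∧ IsSucc p emin f (f + (2 : ℚ) ^ emin) := by
  have h2 := two_zpow_pos emin
  obtain ⟨N, hN⟩ := hf.exists_int_mul_zpow_emin
  -- `|N| ≤ 2^(p-1)`, so `|N ± 1| ≤ 2^(p-1) + 1 ≤ 2^p`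
  have hNabs : |(N : ℚ)| ≤ (2 : ℚ) ^ (p - 1 : ℕ) := by
    have h1 : |(N : ℚ)| * (2 : ℚ) ^ emin ≤ (2 : ℚ) ^ (p - 1 : ℕ) * (2 : ℚ) ^ emin := by
      rw [← abs_of_pos h2, ← abs_mul, abs_of_pos h2, ← hN, ← zpow_natCast,
        ← zpow_add₀ (by norm_num : (2 : ℚ) ≠ 0), Nat.cast_sub hp]
      push_cast; rwa [show (p : ℤ) - 1 + emin = emin + p - 1 by ring]
    exact le_of_mul_le_mul_right h1 h2
  have hpow : (2 : ℤ) ^ (p - 1) + 1 ≤ 2 ^ p := by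
    have : (2 : ℤ) ^ p = 2 ^ (p - 1) * 2 := by rw [← pow_succ]; congr 1; omega
    have h1 : (1 : ℤ) ≤ 2 ^ (p - 1) := one_le_pow₀ (by norm_num)
    linarith
  have hNabs' : |N| ≤ (2 : ℤ) ^ (p - 1) := by
    have : |(N : ℚ)| ≤ ((2 ^ (p - 1) : ℤ) : ℚ) := by push_cast; exact hNabs
    rw [← Int.cast_abs] at this; exact_mod_cast this
  have hF : ∀ s : ℤ, |s| ≤ 1 → IsFloat p emin (f + s * (2 : ℚ) ^ emin) := by
    intro s hs
    have h1 : |N + s| ≤ (2 : ℤ) ^ p := (abs_add_le _ _).trans (by linarith)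
    have := isFloat_of_abs_le (emin := emin) hp h1 le_rfl
    rw [hN]; push_cast at this ⊢; rw [← add_mul]; exact this
  have hFm : IsFloat p emin (f - (2 : ℚ) ^ emin) := by simpa [sub_eq_add_neg] using hF (-1) (by simp)
  have hFp : IsFloat p emin (f + (2 : ℚ) ^ emin) := by simpa using hF 1 (by simp)
  refine ⟨⟨hFm, by linarith, fun h hh hhf => le_sub_eta_of_lt hf hh hhf⟩,
    ⟨hFp, by linarith, fun h hh hfh => ?_⟩⟩
  have := le_sub_eta_of_lt hh hf hfh
  linarith

/-- Eq. (2.24): for `f ∉ U` (`|f| > ½eps⁻¹eta`), `f − 2eps·ufp(f) ≤ pred(f)` and `succ(f) ≤ f + 2eps·ufp(f)`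
— because `f ∓ 2eps·ufp(f) ∈ F` (they lie on the grid `2eps·ufp(f)ℤ ∋ f`, (2.13), within `2ufp(f)`).
[cite: RumpOgitaOishi2008, eq. (2.24)] -/
theorem isFloat_add_two_u_ufp_of_not_mem_U (hp : 1 ≤ p) {f : ℚ} (hf : IsFloat p emin f)
    (hU : (2 : ℚ) ^ (emin + p - 1) < |f|) (s : ℤ) (hs : |s| ≤ 1) :
    IsFloat p emin (f + s * (2 * unitRoundoff p * ufp f)) := by
  have hf0 : f ≠ 0 := by
    rintro rfl; simp at hU; exact absurd hU (not_lt.mpr (two_zpow_pos _).le)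
  set E : ℤ := Int.log 2 |f| with hE
  have hEf : (2 : ℚ) ^ E ≤ |f| := zpow_log_le_abs hf0
  have hfE : |f| < (2 : ℚ) ^ (E + 1) := by
    have := Int.lt_zpow_succ_log_self (by norm_num : 1 < 2) |f|
    exact_mod_cast this
  have hufp : ufp f = (2 : ℚ) ^ E := ufp_of_ne_zero hf0
  have hgrid : 2 * unitRoundoff p * ufp f = (2 : ℚ) ^ (E - p + 1) := by
    rw [hufp, two_mul_u_mul_two_zpow]
  -- `E ≥ emin + p - 1` because `|f| > 2^(emin+p-1)`
  have hElow : emin + p - 1 ≤ E := by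
    by_contra hlt
    have : (2 : ℚ) ^ (E + 1) ≤ (2 : ℚ) ^ (emin + p - 1) := zpow_le_zpow_right₀ (by norm_num) (by omega)
    linarith
  have hfg : OnGrid ((2 : ℚ) ^ (E - p + 1)) f := onGrid_of_isFloat_of_le_abs hf hEf
  have hsg : OnGrid ((2 : ℚ) ^ (E - p + 1)) (s * (2 * unitRoundoff p * ufp f)) := by
    rw [hgrid]; exact (onGrid_self _).int_mul s
  refine isFloat_of_onGrid_two_zpow hp (hfg.add hsg) ?_ (by omega)
  -- `|f + s·2eps·ufp(f)| ≤ |f| + 2eps·ufp(f) ≤ 2^(E+1)` … and `2^p·2^(E-p+1) = 2^(E+1)`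
  have h2E : (2 : ℚ) ^ p * (2 : ℚ) ^ (E - p + 1) = (2 : ℚ) ^ (E + 1) := by
    rw [← zpow_natCast, ← zpow_add₀ (by norm_num : (2 : ℚ) ≠ 0)]; congr 1; ring
  rw [h2E]
  have hs' : |(s : ℚ) * (2 * unitRoundoff p * ufp f)| ≤ (2 : ℚ) ^ (E - p + 1) := by
    rw [abs_mul, hgrid, abs_of_pos (two_zpow_pos _)]
    have : |(s : ℚ)| ≤ 1 := by rw [← Int.cast_abs]; exact_mod_cast hs
    calc |(s : ℚ)| * (2 : ℚ) ^ (E - p + 1) ≤ 1 * (2 : ℚ) ^ (E - p + 1) :=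
          mul_le_mul_of_nonneg_right this (two_zpow_pos _).le
      _ = _ := one_mul _
  -- `|f| ≤ 2^(E+1) - 2^(E-p+1)` since `f` is a float below `2^(E+1)`
  have hfle := abs_le_sub_of_abs_lt_two_zpow hp hf hfE
  rw [show E + 1 - (p : ℤ) = E - p + 1 by ring] at hfle
  calc |f + s * (2 * unitRoundoff p * ufp f)| ≤ |f| + |(s : ℚ) * (2 * unitRoundoff p * ufp f)| :=
        abs_add_le _ _
    _ ≤ ((2 : ℚ) ^ (E + 1) - (2 : ℚ) ^ (E - p + 1)) + (2 : ℚ) ^ (E - p + 1) := add_le_add hfle hs'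
    _ = (2 : ℚ) ^ (E + 1) := by ring

/-- Eq. (2.24): `f ∉ U` ⟹ `f − 2eps·ufp(f) ≤ pred(f) < succ(f) ≤ f + 2eps·ufp(f)`.
[cite: RumpOgitaOishi2008, eq. (2.24)] -/
theorem pred_succ_within_two_u_ufp (hp : 1 ≤ p) {f g h : ℚ} (hf : IsFloat p emin f)
    (hU : (2 : ℚ) ^ (emin + p - 1) < |f|) (hg : IsPred p emin f g) (hh : IsSucc p emin f h) :
    f - 2 * unitRoundoff p * ufp f ≤ g ∧ g < h ∧ h ≤ f + 2 * unitRoundoff p * ufp f := by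
  have hf0 : f ≠ 0 := by
    rintro rfl; simp at hU; exact absurd hU (not_lt.mpr (two_zpow_pos _).le)
  have hpos : 0 < 2 * unitRoundoff p * ufp f := by
    have := ufp_pos hf0; have := u_pos (p := p); positivity
  have hm := isFloat_add_two_u_ufp_of_not_mem_U hp hf hU (-1) (by simp)
  have hp' := isFloat_add_two_u_ufp_of_not_mem_U hp hf hU 1 (by simp)
  simp only [Int.cast_neg, Int.cast_one, neg_mul, one_mul] at hm hp'
  refine ⟨?_, hg.2.1.trans hh.2.1, ?_⟩
  · have := hg.2.2 _ hm (by linarith); linarith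
  · have := hh.2.2 _ hp' (by linarith); linarith

/-! ### §2, Definition 2.3 and Lemma 2.4: faithful rounding -/

/-- **DEFINITION 2.3 (faithful rounding).** "A floating-point number `f` is called a faithful rounding
of a real number `r` if `pred(f) < r < succ(f)`. We denote this by `f ∈ □(r)`." Typed with `pred`/`succ`
unfolded (every float below `f` is below `r`, every float above `f` is above `r`); the equivalence with
the printed form is `isFaithfulRounding_iff_pred_lt_lt_succ`, and with the tree's
`BoldoJeannerodMelquiondMuller2023.IsFaithful` (`f ∈ {RD(r), RU(r)}`) it is `isFaithfulRounding_iff_isFaithful`.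
[cite: RumpOgitaOishi2008, Definition 2.3] -/
def IsFaithfulRounding (p : ℕ) (emin : ℤ) (f r : ℚ) : Prop :=
  IsFloat p emin f ∧ (∀ g : ℚ, IsFloat p emin g → g < f → g < r) ∧
    (∀ g : ℚ, IsFloat p emin g → f < g → r < g)

/-- Definition 2.3 literally: for `f ∈ F`, `f ∈ □(r)` iff `pred(f) < r < succ(f)`.
[cite: RumpOgitaOishi2008, Definition 2.3] -/
theorem isFaithfulRounding_iff_pred_lt_lt_succ (hp : 1 ≤ p) {f r : ℚ} (hf : IsFloat p emin f) :
    IsFaithfulRounding p emin f r ↔ ∀ g h : ℚ, IsPred p emin f g → IsSucc p emin f h → g < r ∧ r < h := by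
  constructor
  · rintro ⟨-, h1, h2⟩ g h hg hh
    exact ⟨h1 g hg.1 hg.2.1, h2 h hh.1 hh.2.1⟩
  · intro H
    obtain ⟨g₀, hg₀⟩ := exists_isPred hp hf
    obtain ⟨h₀, hh₀⟩ := exists_isSucc hp hf
    obtain ⟨hgr, hrh⟩ := H g₀ h₀ hg₀ hh₀
    exact ⟨hf, fun g hg hgf => (hg₀.2.2 g hg hgf).trans_lt hgr,
      fun g hg hfg => hrh.trans_le (hh₀.2.2 g hg hfg)⟩

/-- Definition 2.3 agrees with the tree's notion: `f ∈ □(r)` iff `f ∈ {RD(r), RU(r)}`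
(`BoldoJeannerodMelquiondMuller2023.IsFaithful p emin r f`). [cite: RumpOgitaOishi2008, Definition 2.3] -/
theorem isFaithfulRounding_iff_isFaithful {f r : ℚ} :
    IsFaithfulRounding p emin f r ↔ IsFaithful p emin r f := by
  constructor
  · rintro ⟨hf, h1, h2⟩
    rcases le_or_gt r f with hrf | hfr
    · right
      refine ⟨hf, hrf, fun g hg hrg => ?_⟩
      by_contra hlt
      exact absurd (h1 g hg (not_le.mp hlt)) (not_lt.mpr hrg)
    · left
      refine ⟨hf, hfr.le, fun g hg hgr => ?_⟩
      by_contra hlt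
      exact absurd (h2 g hg (not_le.mp hlt)) (not_lt.mpr hgr)
  · rintro (⟨hf, hfr, hmax⟩ | ⟨hf, hrf, hmin⟩)
    · refine ⟨hf, fun g hg hgf => hgf.trans_le hfr, fun g hg hfg => ?_⟩
      by_contra hle
      exact absurd (hmax g hg (not_lt.mp hle)) (not_le.mpr hfg)
    · refine ⟨hf, fun g hg hgf => ?_, fun g hg hfg => hrf.trans_lt hfg⟩
      by_contra hle
      exact absurd (hmin g hg (not_lt.mp hle)) (not_le.mpr hgf)

/-- "For `r ∈ F` this implies `f = r`." [cite: RumpOgitaOishi2008, Definition 2.3] -/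
theorem IsFaithfulRounding.eq_of_isFloat {f r : ℚ} (h : IsFaithfulRounding p emin f r)
    (hr : IsFloat p emin r) : f = r :=
  (isFaithfulRounding_iff_isFaithful.mp h).eq_self hr

/-- A faithful rounding is a float. [cite: RumpOgitaOishi2008, Definition 2.3] -/
theorem IsFaithfulRounding.isFloat {f r : ℚ} (h : IsFaithfulRounding p emin f r) : IsFloat p emin f := h.1

/-- Rounding to nearest is faithful: `fl(r) ∈ □(r)`. [cite: RumpOgitaOishi2008, Definition 2.3 / eq. (2.7)] -/
theorem isFaithfulRounding_fl (hfl : IsRoundNearest p emin fl) (r : ℚ) :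
    IsFaithfulRounding p emin (fl r) r :=
  isFaithfulRounding_iff_isFaithful.mpr (isFaithful_of_isRoundNearest hfl r)

/-- Eq. (2.26), first clause: `f ∈ □(r)`, `r₁, r₂ ∈ F` (indeed any reals), `r₁ ≤ r ≤ r₂` never forces
anything but — for FLOATS `r₁ ≤ r` — `r₁ ≤ f`: "r₁, r₂ ∈ F and real r with r₁ ≤ r ≤ r₂ ⟹ r₁ ≤ f ≤ r₂".
[cite: RumpOgitaOishi2008, eq. (2.26)] -/
theorem IsFaithfulRounding.le_of_le {f r r₁ : ℚ} (h : IsFaithfulRounding p emin f r)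
    (h₁ : IsFloat p emin r₁) (hle : r₁ ≤ r) : r₁ ≤ f := by
  by_contra hlt
  exact absurd (h.2.2 r₁ h₁ (not_le.mp hlt)) (not_lt.mpr hle)

/-- Eq. (2.26), second clause: `f ∈ □(r)`, `r₂ ∈ F`, `r ≤ r₂` ⟹ `f ≤ r₂`.
[cite: RumpOgitaOishi2008, eq. (2.26)] -/
theorem IsFaithfulRounding.le_of_ge {f r r₂ : ℚ} (h : IsFaithfulRounding p emin f r)
    (h₂ : IsFloat p emin r₂) (hle : r ≤ r₂) : f ≤ r₂ := by
  by_contra hlt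
  exact absurd (h.2.1 r₂ h₂ (not_le.mp hlt)) (not_lt.mpr hle)

/-- Eq. (2.26), "and hence `f ∈ □(0) ⟹ f = 0`" — and more generally the SIGN of a faithful rounding is
that of its argument: `0 ≤ r ⟹ 0 ≤ f`, `r ≤ 0 ⟹ f ≤ 0`. [cite: RumpOgitaOishi2008, eq. (2.26)] -/
theorem IsFaithfulRounding.sign {f r : ℚ} (h : IsFaithfulRounding p emin f r) :
    (0 ≤ r → 0 ≤ f) ∧ (r ≤ 0 → f ≤ 0) ∧ (r = 0 → f = 0) :=
  ⟨fun hr => h.le_of_le (isFloat_zero p emin) hr, fun hr => h.le_of_ge (isFloat_zero p emin) hr,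
    fun hr => le_antisymm (h.le_of_ge (isFloat_zero p emin) hr.le) (h.le_of_le (isFloat_zero p emin) hr.ge)⟩

/-- Eq. (2.18) at the boundary of `U`: if the ROUNDED value satisfies `|fl(r)| ≤ ½eps⁻¹eta` then
`|fl(r) − r| ≤ ½eta` (for `|r|` below the normal range this is (2.18); otherwise `fl(r) = ±½eps⁻¹eta` and
`|fl(r) − r| ≤ eps·ufp(r) ≤ eps·|fl(r)| = ½eta`). [cite: RumpOgitaOishi2008, eq. (2.18)] -/
theorem abs_fl_sub_le_half_eta (hp : 1 ≤ p) (hfl : IsRoundNearest p emin fl) {r : ℚ}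
    (hU : |fl r| ≤ (2 : ℚ) ^ (emin + p - 1)) : |fl r - r| ≤ (2 : ℚ) ^ emin / 2 := by
  rcases lt_or_ge |r| ((2 : ℚ) ^ (emin + p - 1)) with hlt | hge
  · rw [abs_sub_comm]; exact abs_sub_fl_le_of_subnormal hp hfl hlt
  · have h1 := abs_fl_sub_le_u_ufp hp hfl hge
    have hfl0 : fl r ≠ 0 := by
      intro h0
      have := abs_le_abs_fl hfl (isFloat_two_zpow hp (by omega : emin ≤ emin + p - 1)) (t := r)
        (by rwa [abs_of_pos (two_zpow_pos _)])
      rw [h0, abs_zero, abs_of_pos (two_zpow_pos _)] at this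
      exact absurd this (not_le.mpr (two_zpow_pos _))
    have h2 : ufp r ≤ (2 : ℚ) ^ (emin + p - 1) :=
      ((ufp_le_ufp_fl hp hfl hfl0).trans (ufp_le_abs _)).trans hU
    have h3 : unitRoundoff p * (2 : ℚ) ^ (emin + p - 1) = (2 : ℚ) ^ emin / 2 := by
      rw [u_mul_two_zpow, show emin + p - 1 - (p : ℤ) = emin - 1 by ring,
        zpow_sub_one₀ (by norm_num : (2 : ℚ) ≠ 0), div_eq_mul_inv]
    calc |fl r - r| ≤ unitRoundoff p * ufp r := h1
      _ ≤ unitRoundoff p * (2 : ℚ) ^ (emin + p - 1) := mul_le_mul_of_nonneg_left h2 u_pos.le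
      _ = (2 : ℚ) ^ emin / 2 := h3

/-- **LEMMA 2.4, case `r̃ ∉ U`.** `r, δ ∈ ℝ`, `r̃ := fl(r)`; if `|r̃| > ½eps⁻¹eta` and `|δ| < (eps/2)|r̃|`
then `r̃ ∈ □(r + δ)`: a SUFFICIENT criterion for faithful rounding of a perturbed argument. (Proof as
printed, with `r̃ − pred(r̃) ≥ eps|r̃|` — eq. (2.23) in magnitude form — in place of Lemma 2.2's case list.)
[cite: RumpOgitaOishi2008, Lemma 2.4 eq. (2.25)] -/
theorem isFaithfulRounding_fl_of_not_mem_U (hp : 1 ≤ p) (hfl : IsRoundNearest p emin fl) {r δ : ℚ}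
    (hU : (2 : ℚ) ^ (emin + p - 1) < |fl r|) (hδ : 2 * |δ| < unitRoundoff p * |fl r|) :
    IsFaithfulRounding p emin (fl r) (r + δ) := by
  have _ := hU
  set rt := fl r with hrt
  have hF : IsFloat p emin rt := (hfl r).1
  have hnear : ∀ g : ℚ, IsFloat p emin g → |r - rt| ≤ |r - g| := fun g hg => (hfl r).2 g hg
  have hδ1 : -|δ| ≤ δ := neg_abs_le δ
  have hδ2 : δ ≤ |δ| := le_abs_self δ
  refine ⟨hF, fun g hg hgt => ?_, fun g hg hgt => ?_⟩
  · -- floats below `rt` are `≤ rt − eps|rt|`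
    have hgap := u_mul_abs_le_abs_sub hp hF hg hgt.ne
    rw [abs_sub_comm, abs_of_pos (sub_pos.mpr hgt)] at hgap
    rcases le_or_gt rt r with hle | hlt
    · linarith
    · have hgr : g < r := by
        by_contra hge
        have hge : r ≤ g := not_lt.mp hge
        have h1 := hnear g hg
        rw [abs_of_nonpos (by linarith : r - rt ≤ 0), abs_of_nonpos (by linarith : r - g ≤ 0)] at h1
        linarith
      have h1 := hnear g hg
      rw [abs_of_nonpos (by linarith : r - rt ≤ 0), abs_of_nonneg (by linarith : 0 ≤ r - g)] at h1
      linarith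
  · have hgap := u_mul_abs_le_abs_sub hp hF hg hgt.ne'
    rw [abs_of_pos (sub_pos.mpr hgt)] at hgap
    rcases le_or_gt r rt with hle | hlt
    · linarith
    · have hgr : r < g := by
        by_contra hge
        have hge : g ≤ r := not_lt.mp hge
        have h1 := hnear g hg
        rw [abs_of_nonneg (by linarith : 0 ≤ r - rt), abs_of_nonneg (by linarith : 0 ≤ r - g)] at h1
        linarith
      have h1 := hnear g hg
      rw [abs_of_nonneg (by linarith : 0 ≤ r - rt), abs_of_nonpos (by linarith : r - g ≤ 0)] at h1
      linarith

/-- **LEMMA 2.4, case `r̃ ∈ U`.** `r̃ := fl(r)`; if `|r̃| ≤ ½eps⁻¹eta` and `|δ| < ½eta` then `r̃ ∈ □(r + δ)`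
("`fl(r) ∈ U` implies `|r̃ − r| ≤ ½eta`; proceed as before with the `eta`-spacing of Lemma 2.2").
[cite: RumpOgitaOishi2008, Lemma 2.4 eq. (2.25)] -/
theorem isFaithfulRounding_fl_of_mem_U (hp : 1 ≤ p) (hfl : IsRoundNearest p emin fl) {r δ : ℚ}
    (hU : |fl r| ≤ (2 : ℚ) ^ (emin + p - 1)) (hδ : 2 * |δ| < (2 : ℚ) ^ emin) :
    IsFaithfulRounding p emin (fl r) (r + δ) := by
  have herr := abs_fl_sub_le_half_eta hp hfl hU
  set rt := fl r with hrt
  have hF : IsFloat p emin rt := (hfl r).1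
  have hδ1 : -|δ| ≤ δ := neg_abs_le δ
  have hδ2 : δ ≤ |δ| := le_abs_self δ
  have he1 : -|rt - r| ≤ rt - r := neg_abs_le _
  have he2 : rt - r ≤ |rt - r| := le_abs_self _
  refine ⟨hF, fun g hg hgt => ?_, fun g hg hgt => ?_⟩
  · have := le_sub_eta_of_lt hF hg hgt
    linarith
  · have := le_sub_eta_of_lt hg hF hgt
    linarith

/-- **LEMMA 2.4** (both cases in one statement, eq. (2.25)): `r̃ := fl(r) ∈ □(r + δ)` provided
`2|δ| < eps|r̃|` if `r̃ ∉ U` and `2|δ| < eta` if `r̃ ∈ U`. [cite: RumpOgitaOishi2008, Lemma 2.4 eq. (2.25)] -/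
theorem isFaithfulRounding_fl_add (hp : 1 ≤ p) (hfl : IsRoundNearest p emin fl) {r δ : ℚ}
    (hN : (2 : ℚ) ^ (emin + p - 1) < |fl r| → 2 * |δ| < unitRoundoff p * |fl r|)
    (hU : |fl r| ≤ (2 : ℚ) ^ (emin + p - 1) → 2 * |δ| < (2 : ℚ) ^ emin) :
    IsFaithfulRounding p emin (fl r) (r + δ) := by
  rcases lt_or_ge ((2 : ℚ) ^ (emin + p - 1)) |fl r| with h | h
  · exact isFaithfulRounding_fl_of_not_mem_U hp hfl h (hN h)
  · exact isFaithfulRounding_fl_of_mem_U hp hfl h (hU h)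

/-! ### §2, eq. (2.20), second inequality: the error of a floating-point sum in any order -/

/-- `ufp(x) ≤ (n − 1)·2^j` whenever `|x| < n·2^j` and `n ≥ 2` (a power of two strictly below `n·2^j` is at
most `(n − 1)·2^j`): the step behind the factor `n − 1` in (2.20). [cite: RumpOgitaOishi2008, eq. (2.20)] -/
theorem ufp_le_pred_mul_two_zpow {x : ℚ} {n : ℕ} (hn : 2 ≤ n) {j : ℤ}
    (h : |x| < (n : ℚ) * (2 : ℚ) ^ j) : ufp x ≤ ((n : ℚ) - 1) * (2 : ℚ) ^ j := by
  have hn' : (2 : ℚ) ≤ n := by exact_mod_cast hn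
  have h2j := two_zpow_pos j
  by_cases hx : x = 0
  · rw [hx, ufp_zero]; nlinarith
  obtain ⟨e, he⟩ := exists_ufp_eq_two_zpow hx
  have hex : (2 : ℚ) ^ e ≤ |x| := he ▸ ufp_le_abs x
  rw [he]
  rcases le_or_gt e j with hej | hje
  · calc (2 : ℚ) ^ e ≤ (2 : ℚ) ^ j := zpow_le_zpow_right₀ (by norm_num) hej
      _ = 1 * (2 : ℚ) ^ j := (one_mul _).symm
      _ ≤ ((n : ℚ) - 1) * (2 : ℚ) ^ j := mul_le_mul_of_nonneg_right (by linarith) h2j.le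
  · obtain ⟨d, hd⟩ := Int.eq_ofNat_of_zero_le (sub_nonneg.mpr hje.le)
    have h2e : (2 : ℚ) ^ e = ((2 ^ d : ℕ) : ℚ) * (2 : ℚ) ^ j := by
      rw [show e = j + (d : ℤ) by omega, zpow_add₀ (by norm_num : (2 : ℚ) ≠ 0), zpow_natCast]
      push_cast; ring
    have hlt : ((2 ^ d : ℕ) : ℚ) * (2 : ℚ) ^ j < n * (2 : ℚ) ^ j := by rw [← h2e]; exact hex.trans_lt h
    have hlt' : ((2 ^ d : ℕ) : ℚ) < n := lt_of_mul_lt_mul_right hlt h2j.le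
    have hnat : 2 ^ d < n := by exact_mod_cast hlt'
    have hle : 2 ^ d ≤ n - 1 := by omega
    have hle' : ((2 ^ d : ℕ) : ℚ) ≤ (n : ℚ) - 1 := by
      have : ((2 ^ d : ℕ) : ℚ) ≤ ((n - 1 : ℕ) : ℚ) := by exact_mod_cast hle
      rwa [Nat.cast_sub (by omega : 1 ≤ n), Nat.cast_one] at this
    rw [h2e]; exact mul_le_mul_of_nonneg_right hle' h2j.le

/-- **Eq. (2.20), second inequality, in any order of evaluation.** Floats `xᵢ` with `|xᵢ| ≤ 2^j`
(`j ≥ emin`, `n ≤ 2^p` summands, `s̃ = fl(Σ xᵢ)` computed in the order of the tree `t`):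
`|s̃ − Σ xᵢ| ≤ (n(n−1)/2)·eps·2^j` (the source's `2^k/2^M` is `2^j`). Proof by induction over the tree as
printed: an intermediate sum `x` of `m` summands has `|x| ≤ m·2^j`, so either `|x| = m·2^j ∈ F` (no error)
or `ufp(x) ≤ (m − 1)·2^j` and the rounding error is `≤ eps·ufp(x)` by (2.19); summing,
`Σ (m − 1) ≤ n(n − 1)/2` for every tree shape. [cite: RumpOgitaOishi2008, §2 eq. (2.20)] -/
theorem abs_eval_sub_exact_le (hp : 1 ≤ p) (hfl : IsRoundNearest p emin fl) {j : ℤ} (hj : emin ≤ j) :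
    ∀ t : SumTree, (∀ a ∈ t.leaves, IsFloat p emin a ∧ |a| ≤ (2 : ℚ) ^ j) → t.leaves.length ≤ 2 ^ p →
      |t.eval fl - t.exact| ≤
        ((t.leaves.length : ℚ) * ((t.leaves.length : ℚ) - 1) / 2) * (unitRoundoff p * (2 : ℚ) ^ j)
  | .leaf a, _, _ => by simp [eval, exact, leaves]
  | .node l r, h, hn => by
      have hl' : ∀ a ∈ l.leaves, IsFloat p emin a ∧ |a| ≤ (2 : ℚ) ^ j :=
        fun a ha => h a (by simp [leaves, ha])
      have hr' : ∀ a ∈ r.leaves, IsFloat p emin a ∧ |a| ≤ (2 : ℚ) ^ j :=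
        fun a ha => h a (by simp [leaves, ha])
      have hlen : (SumTree.node l r).leaves.length = l.leaves.length + r.leaves.length := by
        simp [leaves]
      rw [hlen] at hn ⊢
      have hnl : l.leaves.length ≤ 2 ^ p := by omega
      have hnr : r.leaves.length ≤ 2 ^ p := by omega
      have ihl := abs_eval_sub_exact_le hp hfl hj l hl' hnl
      have ihr := abs_eval_sub_exact_le hp hfl hj r hr' hnr
      have hxl := abs_eval_le_length_mul hp hfl hj l hl' hnl
      have hxr := abs_eval_le_length_mul hp hfl hj r hr' hnr
      have ha1n : 1 ≤ l.leaves.length := one_le_length_leaves l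
      have hb1n : 1 ≤ r.leaves.length := one_le_length_leaves r
      have ha1 : (1 : ℚ) ≤ l.leaves.length := by exact_mod_cast ha1n
      have hb1 : (1 : ℚ) ≤ r.leaves.length := by exact_mod_cast hb1n
      set a : ℕ := l.leaves.length with ha
      set b : ℕ := r.leaves.length with hb
      have hFl : IsFloat p emin (l.eval fl) := isFloat_eval hfl l fun x hx => (hl' x hx).1
      have hFr : IsFloat p emin (r.eval fl) := isFloat_eval hfl r fun x hx => (hr' x hx).1
      set x : ℚ := l.eval fl + r.eval fl with hxdef
      have h2j := two_zpow_pos j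
      have hupos := u_pos (p := p)
      have hxabs : |x| ≤ ((a + b : ℕ) : ℚ) * (2 : ℚ) ^ j := by
        have := abs_add_le (l.eval fl) (r.eval fl); push_cast; linarith
      -- the rounding error of this node
      have hnode : |fl x - x| ≤ (((a + b : ℕ) : ℚ) - 1) * (unitRoundoff p * (2 : ℚ) ^ j) := by
        rcases hxabs.lt_or_eq with hlt | heq
        · have h1 := abs_fl_add_sub_le_u_ufp hp hfl hFl hFr
          have h2 := ufp_le_pred_mul_two_zpow (by omega : 2 ≤ a + b) hlt
          calc |fl x - x| ≤ unitRoundoff p * ufp x := h1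
            _ ≤ unitRoundoff p * ((((a + b : ℕ) : ℚ) - 1) * (2 : ℚ) ^ j) :=
                mul_le_mul_of_nonneg_left h2 hupos.le
            _ = _ := by ring
        · -- `|x| = (a + b)·2^j ∈ F` (as `a + b ≤ 2^p`): no rounding error
          have hN : |((a + b : ℕ) : ℤ)| ≤ 2 ^ p := by
            rw [abs_of_nonneg (by positivity)]; exact_mod_cast hn
          have hF0 : IsFloat p emin ((((a + b : ℕ) : ℤ) : ℚ) * (2 : ℚ) ^ j) := isFloat_of_abs_le hp hN hj
          have hF0' : IsFloat p emin (((a + b : ℕ) : ℚ) * (2 : ℚ) ^ j) := by exact_mod_cast hF0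
          have hxF : IsFloat p emin x := by
            rcases abs_eq (by positivity : (0 : ℚ) ≤ ((a + b : ℕ) : ℚ) * (2 : ℚ) ^ j) |>.mp heq with hx | hx
            · rw [hx]; exact hF0'
            · rw [hx]; exact hF0'.neg
          rw [fl_eq_self hfl hxF, sub_self, abs_zero]
          have : (1 : ℚ) ≤ ((a + b : ℕ) : ℚ) := by push_cast; linarith
          have := mul_nonneg (by linarith : (0 : ℚ) ≤ ((a + b : ℕ) : ℚ) - 1) (mul_pos hupos h2j).le
          exact this
      -- combine with the two subtrees
      have hsplit : |fl x - (l.exact + r.exact)| ≤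
          |fl x - x| + |l.eval fl - l.exact| + |r.eval fl - r.exact| := by
        have e : fl x - (l.exact + r.exact) =
            (fl x - x) + ((l.eval fl - l.exact) + (r.eval fl - r.exact)) := by
          rw [hxdef]; ring
        rw [e]
        have := abs_add_le (fl x - x) ((l.eval fl - l.exact) + (r.eval fl - r.exact))
        have := abs_add_le (l.eval fl - l.exact) (r.eval fl - r.exact)
        linarith
      have hkey : (((a + b : ℕ) : ℚ) - 1) + (a : ℚ) * ((a : ℚ) - 1) / 2 + (b : ℚ) * ((b : ℚ) - 1) / 2 ≤
          ((a + b : ℕ) : ℚ) * (((a + b : ℕ) : ℚ) - 1) / 2 := by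
        push_cast; nlinarith
      simp only [eval, exact]
      calc |fl x - (l.exact + r.exact)|
          ≤ |fl x - x| + |l.eval fl - l.exact| + |r.eval fl - r.exact| := hsplit
        _ ≤ (((a + b : ℕ) : ℚ) - 1) * (unitRoundoff p * (2 : ℚ) ^ j) +
              (a : ℚ) * ((a : ℚ) - 1) / 2 * (unitRoundoff p * (2 : ℚ) ^ j) +
              (b : ℚ) * ((b : ℚ) - 1) / 2 * (unitRoundoff p * (2 : ℚ) ^ j) := by
            linarith
        _ = ((((a + b : ℕ) : ℚ) - 1) + (a : ℚ) * ((a : ℚ) - 1) / 2 + (b : ℚ) * ((b : ℚ) - 1) / 2) *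
              (unitRoundoff p * (2 : ℚ) ^ j) := by ring
        _ ≤ ((a + b : ℕ) : ℚ) * (((a + b : ℕ) : ℚ) - 1) / 2 * (unitRoundoff p * (2 : ℚ) ^ j) :=
            mul_le_mul_of_nonneg_right hkey (mul_pos hupos h2j).le

/-! ### §4: Algorithm 4.1 (`Transform`) and Algorithm 4.5 (`AccSum`) — the definitions -/

/-- `μ = max(|pᵢ|)` (the first line of Algorithm 4.1; `0` for the empty vector).
[cite: RumpOgitaOishi2008, Algorithm 4.1] -/
def maxAbs : List ℚ → ℚ
  | [] => 0
  | x :: xs => max |x| (maxAbs xs)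

/-- `max |pᵢ| ≥ 0`. [cite: RumpOgitaOishi2008, Algorithm 4.1] -/
theorem maxAbs_nonneg : ∀ xs : List ℚ, 0 ≤ maxAbs xs
  | [] => le_rfl
  | _ :: xs => (maxAbs_nonneg xs).trans (le_max_right _ _)

/-- `|pᵢ| ≤ μ`. [cite: RumpOgitaOishi2008, Algorithm 4.1] -/
theorem abs_le_maxAbs : ∀ {xs : List ℚ} {x : ℚ}, x ∈ xs → |x| ≤ maxAbs xs
  | y :: ys, x, hx => by
      rcases List.mem_cons.mp hx with rfl | hx
      · exact le_max_left _ _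
      · exact (abs_le_maxAbs hx).trans (le_max_right _ _)

/-- `μ` is attained: `μ ≠ 0 ⟹ μ = |pᵢ|` for some `i`. [cite: RumpOgitaOishi2008, Algorithm 4.1] -/
theorem exists_abs_eq_maxAbs : ∀ {xs : List ℚ}, maxAbs xs ≠ 0 → ∃ x ∈ xs, |x| = maxAbs xs
  | [], h => absurd rfl h
  | y :: ys, h => by
      by_cases hys : maxAbs ys ≤ |y|
      · exact ⟨y, by simp, by simp [maxAbs, max_eq_left hys]⟩
      · have hlt : |y| < maxAbs ys := not_le.mp hys
        have hne : maxAbs ys ≠ 0 := by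
          intro h0; rw [h0] at hlt; exact absurd hlt (not_lt.mpr (abs_nonneg y))
        obtain ⟨x, hx, hxeq⟩ := exists_abs_eq_maxAbs hne
        exact ⟨x, by simp [hx], by simp [maxAbs, max_eq_right hlt.le, hxeq]⟩

/-- `μ = 0` iff the vector is zero. [cite: RumpOgitaOishi2008, Algorithm 4.1 ("if μ = 0")] -/
theorem maxAbs_eq_zero_iff {xs : List ℚ} : maxAbs xs = 0 ↔ ∀ x ∈ xs, x = 0 := by
  constructor
  · intro h x hx
    have := abs_le_maxAbs hx
    rw [h] at this
    exact abs_eq_zero.mp (le_antisymm this (abs_nonneg x))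
  · intro h
    by_contra hne
    obtain ⟨x, hx, hxeq⟩ := exists_abs_eq_maxAbs hne
    rw [h x hx, abs_zero] at hxeq
    exact hne hxeq.symm

/-- `fl(Σ pᵢ)`: the floating-point sum of a vector by ordinary recursive summation from the left (the
inner `Σ p⁽ᵐ⁾ᵢ` of Algorithm 4.5, "`res = fl(τ₁ + (τ₂ + Σ pᵢ))`"; the analysis allows any order, see
`faithful_accSum_anyOrder`). [cite: RumpOgitaOishi2008, Algorithm 4.5] -/
def flSum (fl : ℚ → ℚ) : List ℚ → ℚ
  | [] => 0
  | x :: xs => xs.foldl (fun τ q => fl (τ + q)) x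

/-- `fl(Σ pᵢ)` from the left is the evaluation of the left comb on `p₁, …, pₙ`.
[cite: RumpOgitaOishi2008, Algorithm 4.5] -/
theorem flSum_cons_eq_eval (fl : ℚ → ℚ) (x : ℚ) (xs : List ℚ) :
    flSum fl (x :: xs) = (accTree (SumTree.leaf x) xs).eval fl := by
  rw [flSum, eval_accTree]; rfl

/-- **ALGORITHM 4.1 (`Transform`), the `repeat–until` loop**, with the loop state `(t⁽ᵐ⁻¹⁾, σₘ₋₁, p⁽ᵐ⁻¹⁾)`
and explicit fuel: one pass computes `[τ⁽ᵐ⁾, p⁽ᵐ⁾] = ExtractVector(σₘ₋₁, p⁽ᵐ⁻¹⁾)`, `t⁽ᵐ⁾ = fl(t⁽ᵐ⁻¹⁾ + τ⁽ᵐ⁾)`,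
`σₘ = fl(2ᴹeps·σₘ₋₁)`, and stops — returning `[τ₁, τ₂] = FastTwoSum(t⁽ᵐ⁻¹⁾, τ⁽ᵐ⁾)`, `p⁽ᵐ⁾`, `σ = σₘ₋₁` — when
`|t⁽ᵐ⁾| ≥ fl(2²ᴹeps·σₘ₋₁)` or `σₘ₋₁ ≤ ½eps⁻¹eta` (`eta₂`). With fuel `0` it returns the current state unchanged
(never reached with the fuel supplied by `transform`, Lemma 4.2). Arguments: `M`, `eps = u`, `eta₂ = ½eps⁻¹eta`.
[cite: RumpOgitaOishi2008, Algorithm 4.1] -/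
def transformAux (fl : ℚ → ℚ) (M : ℕ) (u eta₂ : ℚ) : ℕ → ℚ → ℚ → List ℚ → ℚ × ℚ × List ℚ × ℚ
  | 0, t, σ, xs => (t, 0, xs, σ)
  | fuel + 1, t, σ, xs =>
      if fl (2 ^ (2 * M) * u * σ) ≤ |fl (t + (extractVector fl σ xs).1)| ∨ σ ≤ eta₂ then
        ((fast2Sum fl t (extractVector fl σ xs).1).1, (fast2Sum fl t (extractVector fl σ xs).1).2,
          (extractVector fl σ xs).2, σ)
      else
        transformAux fl M u eta₂ fuel (fl (t + (extractVector fl σ xs).1)) (fl (2 ^ M * u * σ))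
          (extractVector fl σ xs).2

/-- **ALGORITHM 4.1 (`Transform`, preliminary version): error-free transformation of a vector `p⁽⁰⁾`** into
`[τ₁, τ₂, p⁽ᵐ⁾, σ]`: `μ = max |pᵢ|`; if `μ = 0` then `τ₁ = τ₂ = σ = 0`, `p⁽ᵐ⁾ = 0` (`= p⁽⁰⁾`, the zero
vector); else `M = ⌈log₂(n + 2)⌉`, `σ₀ = 2^(M + ⌈log₂ μ⌉)`, `t⁽⁰⁾ = 0` and the loop `transformAux` (run with
fuel `M + ⌈log₂ μ⌉ − emin + 1`, more than the number of passes, Lemma 4.2). The format parameters `p`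
(`eps = 2^-p`) and `emin` (`½eps⁻¹eta = 2^(emin+p-1)`) are arguments, as `eps`/`realmin` are in the
source's Matlab code; the logarithms are used "for clarity … later replaced by `NextPowerTwo`" (Remark 2;
Algorithm 3.6 is not typed here). [cite: RumpOgitaOishi2008, Algorithm 4.1] -/
def transform (fl : ℚ → ℚ) (p : ℕ) (emin : ℤ) (xs : List ℚ) : ℚ × ℚ × List ℚ × ℚ :=
  if maxAbs xs = 0 then (0, 0, xs, 0)
  else
    transformAux fl (Nat.clog 2 (xs.length + 2)) (unitRoundoff p) ((2 : ℚ) ^ (emin + p - 1))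
      (((Nat.clog 2 (xs.length + 2) : ℤ) + Int.clog 2 (maxAbs xs) - emin).toNat + 1) 0
      ((2 : ℚ) ^ ((Nat.clog 2 (xs.length + 2) : ℤ) + Int.clog 2 (maxAbs xs))) xs

/-- **ALGORITHM 4.5 (`AccSum`): accurate summation with faithful rounding.**
`[τ₁, τ₂, p′] = Transform(p)`, `res = fl(τ₁ + (τ₂ + Σ p′ᵢ))` (the inner sum by `flSum`; `Transform` in its
preliminary form Algorithm 4.1 — the final Algorithm 4.4 differs only in an additional check for zero and
returns results satisfying the same Lemmas 4.2–4.3, see the header NOTES). [cite: RumpOgitaOishi2008, Algorithm 4.5] -/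
def accSum (fl : ℚ → ℚ) (p : ℕ) (emin : ℤ) (xs : List ℚ) : ℚ :=
  fl ((transform fl p emin xs).1 +
    fl ((transform fl p emin xs).2.1 + flSum fl (transform fl p emin xs).2.2.1))

/-! ### §4, Lemma 4.2: the loop invariant and the stopping state of `Transform` -/

/-- The assertions of LEMMA 4.2 on the results `[τ₁, τ₂, p⁽ᵐ⁾, σ]` of `Transform` (`σ = σₘ₋₁`, with
`t = t⁽ᵐ⁻¹⁾`, `τ = τ⁽ᵐ⁾` the values of the last pass), for the exact sum `s` of the input of length `n`:
`σ = 2^k ≥ eta` (`two_zpow`); `p⁽ᵐ⁾` has length `n`, entries in `F` with `max |p⁽ᵐ⁾ᵢ| ≤ epsσ` (4.3); `τ₁, τ₂ ∈ F`;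
(4.2) `s = t + τ + Σ p⁽ᵐ⁾ᵢ`, (4.3) `t, τ ∈ F ∩ epsσℤ`, `|τ| < σ`, (4.4) `τ₁ + τ₂ = t + τ`, `τ₁ = fl(t + τ) = t⁽ᵐ⁾`,
with (2.27) `|τ₂| ≤ eps·ufp(τ₁)` (`last`); and (4.5) `σ > ½eps⁻¹eta ⟹ |τ₁| ≥ 2²ᴹepsσ` (hence
`ufp(τ₁) ≥ 2²ᴹepsσ`, `exit`). [cite: RumpOgitaOishi2008, Lemma 4.2 eqs. (4.2)–(4.5)] -/
structure TransformSpec (p : ℕ) (emin : ℤ) (fl : ℚ → ℚ) (M : ℕ) (s : ℚ) (n : ℕ)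
    (τ₁ τ₂ : ℚ) (xs' : List ℚ) (σ : ℚ) : Prop where
  two_zpow : ∃ k : ℤ, emin ≤ k ∧ σ = (2 : ℚ) ^ k
  length_eq : xs'.length = n
  low : ∀ x ∈ xs', IsFloat p emin x ∧ |x| ≤ unitRoundoff p * σ
  isFloat₁ : IsFloat p emin τ₁
  isFloat₂ : IsFloat p emin τ₂
  last : ∃ t τ : ℚ, IsFloat p emin t ∧ IsFloat p emin τ ∧ OnGrid (unitRoundoff p * σ) t ∧
    OnGrid (unitRoundoff p * σ) τ ∧ |τ| < σ ∧ s = t + τ + xs'.sum ∧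
    τ₁ + τ₂ = t + τ ∧ τ₁ = fl (t + τ) ∧ |τ₂| ≤ unitRoundoff p * ufp τ₁
  exit : (2 : ℚ) ^ (emin + p - 1) < σ → 2 ^ (2 * M) * unitRoundoff p * σ ≤ |τ₁|

/-- The length of `p′ = ExtractVector(σ, p)₂` is that of `p`. [cite: RumpOgitaOishi2008, Algorithm 3.4] -/
theorem length_extractVector_snd (fl : ℚ → ℚ) (σ : ℚ) (xs : List ℚ) :
    (extractVector fl σ xs).2.length = xs.length := by
  simp [extractVector_eq]

/-- The entries of `p′ = ExtractVector(σ, p)₂` are floats. [cite: RumpOgitaOishi2008, Algorithm 3.4] -/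
theorem isFloat_of_mem_extractVector_snd (hfl : IsRoundNearest p emin fl) (σ : ℚ) (xs : List ℚ) :
    ∀ x ∈ (extractVector fl σ xs).2, IsFloat p emin x := by
  intro x hx
  rw [extractVector_eq] at hx
  simp only [List.mem_map] at hx
  obtain ⟨y, -, rfl⟩ := hx
  exact (isFloat_extractScalar hfl σ y).2

/-- `2^a·eps·2^k = 2^(k + a − p)` (the constants `2ᴹepsσ`, `2²ᴹepsσ` of Algorithm 4.1 are powers of two).
[cite: RumpOgitaOishi2008, Algorithm 4.1] -/
theorem two_pow_mul_u_mul_two_zpow (a : ℕ) (k : ℤ) :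
    (2 : ℚ) ^ a * unitRoundoff p * (2 : ℚ) ^ k = (2 : ℚ) ^ (k + a - p) := by
  rw [mul_assoc, u_mul_two_zpow, ← zpow_natCast, ← zpow_add₀ (by norm_num : (2 : ℚ) ≠ 0)]
  congr 1; ring

/-- **LEMMA 4.2, the loop.** Entering a pass with `σ = 2^k`, `k ≥ emin`, `p⁽ᵐ⁻¹⁾` of length `n` with
`n + 2 ≤ 2^M`, entries in `F` bounded by `2^-M σ`, `t⁽ᵐ⁻¹⁾ ∈ F ∩ epsσℤ`, `s = t⁽ᵐ⁻¹⁾ + Σ p⁽ᵐ⁻¹⁾ᵢ`, and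
`2²ᴹeps ≤ 1` (`2M ≤ p`), the loop terminates (within `k − emin + 1` passes) in a state satisfying
`TransformSpec`: while it continues, `σₘ₋₁ > ½eps⁻¹eta` makes `σₘ = 2ᴹepsσₘ₋₁` and `2²ᴹepsσₘ₋₁` exact powers of
two, `|t⁽ᵐ⁾| < 2²ᴹepsσₘ₋₁ ≤ σₘ₋₁` makes `t⁽ᵐ⁾ = t⁽ᵐ⁻¹⁾ + τ⁽ᵐ⁾` exact by (2.21), and Theorem 3.5 supplies (4.2)–(4.3);
at the exit Lemma 2.6 (`t⁽ᵐ⁻¹⁾ ∈ epsσℤ ⊆ 2eps·ufp(τ⁽ᵐ⁾)ℤ` as `|τ⁽ᵐ⁾| < σ`) gives (4.4) and `|τ₂| ≤ eps·ufp(τ₁)`.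
[cite: RumpOgitaOishi2008, Lemma 4.2 (proof, eqs. (4.6)–(4.8))] -/
theorem transformAux_spec (hp : 1 ≤ p) (hfl : IsRoundNearest p emin fl) {M : ℕ} (h2M : 2 * M ≤ p)
    {n : ℕ} (hnM : n + 2 ≤ 2 ^ M) (s : ℚ) :
    ∀ (fuel : ℕ) (t : ℚ) (k : ℤ) (xs : List ℚ), emin ≤ k → k - emin < fuel → xs.length = n →
      (∀ x ∈ xs, IsFloat p emin x ∧ |x| ≤ (2 : ℚ) ^ (k - M)) → IsFloat p emin t →
      OnGrid (unitRoundoff p * (2 : ℚ) ^ k) t → s = t + xs.sum →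
      TransformSpec p emin fl M s n
        (transformAux fl M (unitRoundoff p) ((2 : ℚ) ^ (emin + p - 1)) fuel t ((2 : ℚ) ^ k) xs).1
        (transformAux fl M (unitRoundoff p) ((2 : ℚ) ^ (emin + p - 1)) fuel t ((2 : ℚ) ^ k) xs).2.1
        (transformAux fl M (unitRoundoff p) ((2 : ℚ) ^ (emin + p - 1)) fuel t ((2 : ℚ) ^ k) xs).2.2.1
        (transformAux fl M (unitRoundoff p) ((2 : ℚ) ^ (emin + p - 1)) fuel t ((2 : ℚ) ^ k) xs).2.2.2
  | 0, t, k, xs, hk, hfuel, _, _, _, _, _ => absurd hfuel (by push_cast; omega)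
  | fuel + 1, t, k, xs, hk, hfuel, hlen, hxs, ht, htg, hs => by
      have hM : M < p := by omega
      have hnlt : xs.length < 2 ^ M := by rw [hlen]; omega
      have hdiv : (2 : ℚ) ^ k / 2 ^ M = (2 : ℚ) ^ (k - M) := by
        rw [zpow_sub₀ (by norm_num : (2 : ℚ) ≠ 0), zpow_natCast]
      have hxs' : ∀ x ∈ xs, IsFloat p emin x ∧ |x| ≤ (2 : ℚ) ^ k / 2 ^ M := by
        intro x hx; rw [hdiv]; exact hxs x hx
      obtain ⟨hsum, hlo, hτabs, hnσ, hτg, -, hτF⟩ := extractVector_eft hp hfl hk hM hxs' hnlt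
      have hτlt : |(extractVector fl ((2 : ℚ) ^ k) xs).1| < (2 : ℚ) ^ k := hτabs.trans_lt hnσ
      simp only [transformAux]
      set τ : ℚ := (extractVector fl ((2 : ℚ) ^ k) xs).1 with hτdef
      set xs₁ : List ℚ := (extractVector fl ((2 : ℚ) ^ k) xs).2 with hxs₁def
      have hlen₁ : xs₁.length = n := by rw [hxs₁def, length_extractVector_snd, hlen]
      have hxs₁F : ∀ x ∈ xs₁, IsFloat p emin x := isFloat_of_mem_extractVector_snd hfl _ xs
      have hupos := u_pos (p := p)
      have h2k := two_zpow_pos k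
      split_ifs with hstop
      · -- the loop stops: `[τ₁, τ₂] = FastTwoSum(t, τ)`
        have hft : (fast2Sum fl t τ).1 = fl (t + τ) := rfl
        -- Lemma 2.6 / FastTwoSum: `τ₁ + τ₂ = t + τ`, `|τ₂| ≤ eps·ufp(τ₁)`
        have hF2S : (fast2Sum fl t τ).1 + (fast2Sum fl t τ).2 = t + τ ∧
            |(fast2Sum fl t τ).2| ≤ unitRoundoff p * ufp (fast2Sum fl t τ).1 := by
          by_cases hτ0 : τ = 0
          · obtain ⟨-, h2, h3⟩ := fast2Sum_correct hp hfl ht hτF (by rw [hτ0, abs_zero]; exact abs_nonneg t)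
            refine ⟨h3, ?_⟩
            rw [h2, hτ0, add_zero, fl_eq_self hfl ht, sub_self, abs_zero]
            exact mul_nonneg hupos.le (ufp_nonneg _)
          · -- `t ∈ epsσℤ = 2^(k-p)ℤ ⊆ 2eps·ufp(τ)ℤ` because `ufp(τ) ≤ 2^(k-1)`
            obtain ⟨e, he⟩ := exists_ufp_eq_two_zpow hτ0
            have hek : e ≤ k - 1 := by
              have h1 : ufp τ ≤ (2 : ℚ) ^ (k - 1) :=
                ufp_le_two_zpow_of_abs_lt (by rwa [show k - 1 + 1 = k by ring])
              rw [he] at h1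
              exact (zpow_le_zpow_iff_right₀ (by norm_num : (1 : ℚ) < 2)).mp h1
            have htg' : OnGrid (2 * unitRoundoff p * ufp τ) t := by
              rw [he, two_mul_u_mul_two_zpow]
              rw [u_mul_two_zpow] at htg
              exact htg.of_le (by omega)
            obtain ⟨-, -, h3, h4, h5⟩ := fastTwoSum_eft hp hfl ht hτF htg'
            exact ⟨h3, h4.trans h5⟩
        refine
          { two_zpow := ⟨k, hk, rfl⟩
            length_eq := hlen₁
            low := fun x hx => ⟨hxs₁F x hx, hlo x hx⟩
            isFloat₁ := (hfl _).1
            isFloat₂ := (hfl _).1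
            last := ⟨t, τ, ht, hτF, htg, hτg, hτlt, by rw [hs, hsum]; ring, hF2S.1, hft, hF2S.2⟩
            exit := fun hσ => ?_ }
        -- (4.5): the second exit condition fails, so the first one holds, and `fl(2²ᴹepsσ) = 2²ᴹepsσ`
        have hkp : emin + p ≤ k := by
          by_contra hlt
          have : (2 : ℚ) ^ k ≤ (2 : ℚ) ^ (emin + p - 1) := zpow_le_zpow_right₀ (by norm_num) (by omega)
          exact absurd hσ (not_lt.mpr this)
        have hexact : fl (2 ^ (2 * M) * unitRoundoff p * (2 : ℚ) ^ k) =
            2 ^ (2 * M) * unitRoundoff p * (2 : ℚ) ^ k := by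
          rw [two_pow_mul_u_mul_two_zpow]
          exact fl_eq_self hfl (isFloat_two_zpow hp (by push_cast; omega))
        rcases hstop with h | h
        · simpa [hexact, hft] using h
        · exact absurd hσ (not_lt.mpr h)
      · -- the loop continues with `t' = t + τ` (exact), `σ' = 2ᴹepsσ = 2^(k+M-p)`, `p' = xs₁`
        obtain ⟨hlt, hσgt⟩ := not_or.mp hstop
        have hlt : |fl (t + τ)| < fl (2 ^ (2 * M) * unitRoundoff p * (2 : ℚ) ^ k) := not_le.mp hlt
        have hσgt : (2 : ℚ) ^ (emin + p - 1) < (2 : ℚ) ^ k := not_le.mp hσgt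
        have hkp : emin + p ≤ k := by
          by_contra hlt'
          have : (2 : ℚ) ^ k ≤ (2 : ℚ) ^ (emin + p - 1) := zpow_le_zpow_right₀ (by norm_num) (by omega)
          exact absurd hσgt (not_lt.mpr this)
        have hρ : fl (2 ^ (2 * M) * unitRoundoff p * (2 : ℚ) ^ k) = (2 : ℚ) ^ (k + (2 * M : ℕ) - p) := by
          rw [two_pow_mul_u_mul_two_zpow]
          exact fl_eq_self hfl (isFloat_two_zpow hp (by push_cast; omega))
        have hσ' : fl (2 ^ M * unitRoundoff p * (2 : ℚ) ^ k) = (2 : ℚ) ^ (k + M - p) := by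
          rw [two_pow_mul_u_mul_two_zpow]
          exact fl_eq_self hfl (isFloat_two_zpow hp (by omega))
        -- `t' = fl(t + τ) = t + τ`: `|fl(t + τ)| < 2²ᴹepsσ ≤ σ` and `t, τ ∈ F ∩ epsσℤ` (eq. (2.21))
        have ht'lt : |fl (t + τ)| < (2 : ℚ) ^ k := by
          rw [hρ] at hlt
          exact hlt.trans_le (zpow_le_zpow_right₀ (by norm_num) (by push_cast; omega))
        have ht'eq : fl (t + τ) = t + τ := fl_add_eq_add_of_abs_fl_lt hp hfl ht hτF htg hτg ht'lt
        -- the invariant for the next pass, with `k' = k + M - p`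
        have hk' : emin ≤ k + M - p := by omega
        have hfuel' : k + M - p - emin < fuel := by push_cast at hfuel ⊢; omega
        have hxs₁' : ∀ x ∈ xs₁, IsFloat p emin x ∧ |x| ≤ (2 : ℚ) ^ (k + M - p - M) := by
          intro x hx
          refine ⟨hxs₁F x hx, ?_⟩
          have := hlo x hx
          rwa [u_mul_two_zpow, show k - (p : ℤ) = k + M - p - M by ring] at this
        have ht'g : OnGrid (unitRoundoff p * (2 : ℚ) ^ (k + M - p)) (fl (t + τ)) := by
          rw [ht'eq, u_mul_two_zpow]
          have := htg.add hτg
          rw [u_mul_two_zpow] at this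
          exact this.of_le (by omega)
        have hs' : s = fl (t + τ) + xs₁.sum := by rw [ht'eq, hs, hsum]; ring
        have IH := transformAux_spec hp hfl h2M hnM s fuel (fl (t + τ)) (k + M - p) xs₁ hk' hfuel' hlen₁
          hxs₁' (hfl _).1 ht'g hs'
        rwa [hσ']



/-- **LEMMA 4.2** for Algorithm 4.1: applied to a nonzero vector `p⁽⁰⁾` of `n` floating-point numbers
with `M := ⌈log₂(n + 2)⌉`, `2²ᴹeps ≤ 1`, `Transform` stops and its results satisfy (4.2)–(4.5)
(`TransformSpec`) for `s := Σ p⁽⁰⁾ᵢ`. Entry of the loop: `μ = |p⁽⁰⁾ᵢ| ≥ eta` for some `i` (a nonzero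
float), so `σ₀ = 2^(M + ⌈log₂ μ⌉) ≥ eta` and `max |p⁽⁰⁾ᵢ| = μ ≤ 2^⌈log₂ μ⌉ = 2^-M σ₀`.
[cite: RumpOgitaOishi2008, Lemma 4.2] -/
theorem transform_spec (hp : 1 ≤ p) (hfl : IsRoundNearest p emin fl) {xs : List ℚ}
    (hxs : ∀ x ∈ xs, IsFloat p emin x) (hne : maxAbs xs ≠ 0)
    (h2M : 2 * Nat.clog 2 (xs.length + 2) ≤ p) :
    TransformSpec p emin fl (Nat.clog 2 (xs.length + 2)) xs.sum xs.length (transform fl p emin xs).1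
      (transform fl p emin xs).2.1 (transform fl p emin xs).2.2.1 (transform fl p emin xs).2.2.2 := by
  have hnM : xs.length + 2 ≤ 2 ^ Nat.clog 2 (xs.length + 2) := Nat.le_pow_clog (by norm_num) _
  -- `μ = |pᵢ| ≥ eta` for a nonzero float `pᵢ`, hence `⌈log₂ μ⌉ ≥ emin`
  obtain ⟨x, hx, hxμ⟩ := exists_abs_eq_maxAbs hne
  have hx0 : x ≠ 0 := by intro h; rw [h, abs_zero] at hxμ; exact hne hxμ.symm
  have hμeta : (2 : ℚ) ^ emin ≤ maxAbs xs := hxμ ▸ two_zpow_emin_le_abs (hxs x hx) hx0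
  have hμK : maxAbs xs ≤ (2 : ℚ) ^ Int.clog 2 (maxAbs xs) := by
    have := Int.self_le_zpow_clog (R := ℚ) (b := 2) (by norm_num) (maxAbs xs); exact_mod_cast this
  have heminK : emin ≤ Int.clog 2 (maxAbs xs) := by
    have h1 := Int.clog_mono_right (b := 2) (two_zpow_pos emin) hμeta
    have h2 : Int.clog 2 ((2 : ℚ) ^ emin) = emin := by
      have := Int.clog_zpow (R := ℚ) (b := 2) (by norm_num) emin; exact_mod_cast this
    rwa [h2] at h1
  rw [transform, if_neg hne]
  exact transformAux_spec hp hfl h2M hnM xs.sum _ 0 _ xs (by omega) (by omega) rfl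
    (fun y hy => ⟨hxs y hy, by
      rw [show ((Nat.clog 2 (xs.length + 2) : ℤ) + Int.clog 2 (maxAbs xs) - (Nat.clog 2 (xs.length + 2) : ℤ))
          = Int.clog 2 (maxAbs xs) by ring]
      exact (abs_le_maxAbs hy).trans hμK⟩)
    (isFloat_zero p emin) (onGrid_zero _) (by simp)

/-- On the zero vector `Transform` returns `τ₁ = τ₂ = σ = 0` and `p⁽ᵐ⁾ = p⁽⁰⁾ (= 0)`.
[cite: RumpOgitaOishi2008, Algorithm 4.1 ("if μ = 0")] -/
theorem transform_of_maxAbs_eq_zero (fl : ℚ → ℚ) (p : ℕ) (emin : ℤ) {xs : List ℚ} (h : maxAbs xs = 0) :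
    transform fl p emin xs = (0, 0, xs, 0) := by
  rw [transform, if_pos h]

/-! ### §4, Lemma 4.3: `res = fl(τ₁ + (τ₂ + Σ p⁽ᵐ⁾ᵢ))` is a faithful rounding of `s` -/

/-- **LEMMA 4.3 (with its proof, eqs. (4.13)–(4.23)) over the assertions of Lemma 4.2.** Let
`τ₁, τ₂, p⁽ᵐ⁾ =: p′, σ` satisfy (4.2)–(4.5) (`TransformSpec`) for a sum `s` of `n ≥ 1` terms, `M ≥ 2`,
`n + 2 ≤ 2ᴹ`, `2²ᴹeps ≤ 1` (so `eps ≤ 1/16`), and let `τ₃ ∈ F` be ANY floating-point evaluation of `Σ p′ᵢ` obeying,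
when `σ > ½eps⁻¹eta`, (4.15) `|τ₃| ≤ n·epsσ =: n·eps·σ` and (2.20) `|τ₃ − Σ p′ᵢ| ≤ ½n(n−1)eps·(epsσ)`, and `τ₃ = 0`
when `p′ = 0`. Then with `τ₂′ = fl(τ₂ + τ₃)`, `res = fl(τ₁ + τ₂′)`:
`res` is a faithful rounding of `s`; `res = 0 ⟹ τ₁ = τ₂ = 0, p′ = 0, s = 0`; and for `res ≠ 0` (4.11)
`|s − res| < 2eps(1 − 2^(−M−1))ufp(res)`.
Proof as in the source: if `σ ≤ ½eps⁻¹eta` then `p′ = 0`, `res = τ₁ = fl(τ₁ + τ₂) = fl(s)`; else with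
`δ = (τ₂ + τ₃ − τ₂′) + (Σ p′ᵢ − τ₃)` one has `s = τ₁ + τ₂′ + δ`, (4.18)–(4.20)
`2|δ| ≤ eps(2eps·ufp(τ₁) + n(n+1)epsσ)`, (4.17) `|res| ≥ (1 − 2eps)|τ₁| − n·epsσ`, and by (4.5)
`ufp(τ₁) ≥ 2²ᴹepsσ` the comparison (4.21) `2ᴹ·2|δ| < (2ᴹ − 1)eps|res|` (strict here via `n ≥ 1`), whence
`2|δ| < eps|res|` (and `|res| < eps⁻¹eta ⟹ 2|δ| < eta ⟹ δ = 0` as `δ ∈ etaℤ`), so Lemma 2.4 applies; (4.22)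
gives (4.11). [cite: RumpOgitaOishi2008, Lemma 4.3 (proof, eqs. (4.13)–(4.23))] -/
theorem faithful_of_transformSpec (hfl : IsRoundNearest p emin fl) {M : ℕ} (hM : 2 ≤ M)
    (h2M : 2 * M ≤ p) {n : ℕ} (hn : 1 ≤ n) (hnM : n + 2 ≤ 2 ^ M) {s τ₁ τ₂ σ : ℚ} {xs' : List ℚ}
    (H : TransformSpec p emin fl M s n τ₁ τ₂ xs' σ) {τ₃ : ℚ} (hτ₃F : IsFloat p emin τ₃)
    (hτ₃abs : (2 : ℚ) ^ (emin + p - 1) < σ → |τ₃| ≤ n * (unitRoundoff p * σ))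
    (hτ₃err : (2 : ℚ) ^ (emin + p - 1) < σ →
      |τ₃ - xs'.sum| ≤ ((n : ℚ) * ((n : ℚ) - 1) / 2) * (unitRoundoff p * (unitRoundoff p * σ)))
    (hτ₃z : (∀ x ∈ xs', x = 0) → τ₃ = 0) :
    IsFaithfulRounding p emin (fl (τ₁ + fl (τ₂ + τ₃))) s ∧
      (fl (τ₁ + fl (τ₂ + τ₃)) = 0 → τ₁ = 0 ∧ τ₂ = 0 ∧ (∀ x ∈ xs', x = 0) ∧ s = 0) ∧
      (fl (τ₁ + fl (τ₂ + τ₃)) ≠ 0 → |s - fl (τ₁ + fl (τ₂ + τ₃))| <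
        2 * unitRoundoff p * (1 - 1 / 2 ^ (M + 1)) * ufp (fl (τ₁ + fl (τ₂ + τ₃)))) := by
  have hp : 1 ≤ p := by omega
  obtain ⟨k, hk, hσk⟩ := H.two_zpow
  obtain ⟨t, τ, htF, hτF, htg, hτg, hτlt, hs, h12, h1, hτ₂le⟩ := H.last
  have hτ₁F := H.isFloat₁
  have hτ₂F := H.isFloat₂
  have hu0 : 0 < unitRoundoff p := u_pos
  -- the factor `2(1 − 2^(−M−1)) > 1`
  have hfac : (1 : ℚ) < 2 * (1 - 1 / 2 ^ (M + 1)) := by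
    have : (1 : ℚ) / 2 ^ (M + 1) ≤ 1 / 8 := by
      apply one_div_le_one_div_of_le (by norm_num)
      calc (8 : ℚ) = 2 ^ 3 := by norm_num
        _ ≤ 2 ^ (M + 1) := pow_le_pow_right₀ (by norm_num) (by omega)
    linarith only [this]
  rcases le_or_gt σ ((2 : ℚ) ^ (emin + p - 1)) with hσU | hσN
  · /- Case `σ ≤ ½eps⁻¹eta` (p. 19 top): `p′ = 0` by (4.8), `τ₃ = 0`, so
       `res = fl(τ₁ + τ₂) = fl(t + τ) = τ₁ = fl(s)` is a (faithful) rounding to nearest of `s`. -/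
    have hzero : ∀ x ∈ xs', x = 0 := by
      intro x hx
      obtain ⟨hxF, hxle⟩ := H.low x hx
      refine eq_zero_of_isFloat_of_abs_lt hxF (hxle.trans_lt ?_)
      calc unitRoundoff p * σ ≤ unitRoundoff p * (2 : ℚ) ^ (emin + p - 1) :=
            mul_le_mul_of_nonneg_left hσU hu0.le
        _ = (2 : ℚ) ^ (emin - 1) := by rw [u_mul_two_zpow]; congr 1; ring
        _ < (2 : ℚ) ^ emin := zpow_lt_zpow_right₀ (by norm_num) (by omega)
    have hτ₃0 : τ₃ = 0 := hτ₃z hzero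
    have hsum0 : xs'.sum = 0 := List.sum_eq_zero hzero
    have hres₁ : fl (τ₁ + fl (τ₂ + τ₃)) = τ₁ := by
      rw [hτ₃0, add_zero, fl_eq_self hfl hτ₂F, h12, ← h1]
    have hsval : s = τ₁ + τ₂ := by rw [hs, hsum0, add_zero, h12]
    refine ⟨?_, ?_, ?_⟩
    · have : fl (τ₁ + fl (τ₂ + τ₃)) = fl s := by rw [hres₁, h1, ← h12, ← hsval]
      rw [this]
      exact isFaithfulRounding_fl hfl s
    · intro hres0
      have hτ₁0 : τ₁ = 0 := hres₁ ▸ hres0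
      have htτ : t + τ = 0 := by
        by_contra hne
        have := eta_le_abs_fl_add hp hfl htF hτF hne
        rw [← h1, hτ₁0, abs_zero] at this
        exact absurd this (not_le.mpr (two_zpow_pos emin))
      have hτ₂0 : τ₂ = 0 := by linarith only [h12, htτ, hτ₁0]
      exact ⟨hτ₁0, hτ₂0, hzero, by rw [hsval, hτ₁0, hτ₂0, add_zero]⟩
    · intro hres0
      rw [hres₁] at hres0 ⊢
      rw [hsval, show τ₁ + τ₂ - τ₁ = τ₂ by ring]
      have hpos : 0 < unitRoundoff p * ufp τ₁ := mul_pos hu0 (ufp_pos hres0)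
      calc |τ₂| ≤ unitRoundoff p * ufp τ₁ := hτ₂le
        _ = 1 * (unitRoundoff p * ufp τ₁) := (one_mul _).symm
        _ < 2 * (1 - 1 / 2 ^ (M + 1)) * (unitRoundoff p * ufp τ₁) := mul_lt_mul_of_pos_right hfac hpos
        _ = 2 * unitRoundoff p * (1 - 1 / 2 ^ (M + 1)) * ufp τ₁ := by ring
  · /- Case `σ > ½eps⁻¹eta` (pp. 19–20). Atoms: `u = eps`, `e = epsσ`, `A = ufp(τ₁)`, `T = |τ₁|`,
       `m = 2ᴹ`, `Q = |τ₂ + τ₃|`. -/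
    set u := unitRoundoff p with hu
    set e := u * σ with he
    set A := ufp τ₁ with hA
    set T := |τ₁| with hT
    set m : ℚ := (2 : ℚ) ^ M with hm
    have he0 : 0 < e := mul_pos hu0 (hσk ▸ two_zpow_pos k)
    have hm4 : 4 ≤ m := by
      calc (4 : ℚ) = 2 ^ 2 := by norm_num
        _ ≤ 2 ^ M := pow_le_pow_right₀ (by norm_num) hM
    have hnm : (n : ℚ) + 2 ≤ m := by rw [hm]; exact_mod_cast hnM
    have hn1 : (1 : ℚ) ≤ n := by exact_mod_cast hn
    -- `2ᴹ⁺²eps ≤ 1` from `M + 2 ≤ 2M ≤ p`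
    have h4um : 4 * u * m ≤ 1 := by
      have h1 : (2 : ℚ) ^ (M + 2) ≤ 2 ^ p := pow_le_pow_right₀ (by norm_num) (by omega)
      have h2 : (0 : ℚ) < 2 ^ p := by positivity
      rw [pow_add] at h1
      rw [hu, hm, unitRoundoff, show 4 * (1 / (2 : ℚ) ^ p) * 2 ^ M = (2 ^ M * 2 ^ 2) / 2 ^ p by ring,
        div_le_one h2]
      exact h1
    -- (4.5): `A = ufp(τ₁) ≥ 2²ᴹepsσ = m²e`
    have hρA : m * m * e ≤ A := by
      have h1 := H.exit hσN
      rw [hσk, two_pow_mul_u_mul_two_zpow] at h1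
      have h2 := two_zpow_le_ufp h1
      rw [← two_pow_mul_u_mul_two_zpow, ← hσk, two_mul, pow_add] at h2
      have h3 : m * m * e = 2 ^ M * 2 ^ M * unitRoundoff p * σ := by rw [hm, he, hu]; ring
      rw [h3]; exact h2
    have hA0 : 0 < A := lt_of_lt_of_le (by positivity) hρA
    have hτ₁0 : τ₁ ≠ 0 := by intro h; rw [hA, h, ufp_zero] at hA0; exact lt_irrefl _ hA0
    have hAT : A ≤ T := ufp_le_abs τ₁
    -- (4.14)/(4.15): `|τ₂| ≤ uA`, `|τ₃| ≤ ne`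
    have hτ₃abs' : |τ₃| ≤ n * e := hτ₃abs hσN
    have hτ₃err' : |τ₃ - xs'.sum| ≤ ((n : ℚ) * ((n : ℚ) - 1) / 2) * (u * e) := hτ₃err hσN
    set Q := |τ₂ + τ₃| with hQ
    have hQle : Q ≤ u * A + n * e := (abs_add_le τ₂ τ₃).trans (add_le_add hτ₂le hτ₃abs')
    -- `τ₂′ = fl(τ₂ + τ₃)`: (4.16) `|τ₂′ − (τ₂ + τ₃)| ≤ eps·|τ₂ + τ₃|`
    set τ₂' := fl (τ₂ + τ₃) with hτ₂'
    have hτ₂'F : IsFloat p emin τ₂' := (hfl _).1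
    have hd₂ : |τ₂' - (τ₂ + τ₃)| ≤ u * Q :=
      (abs_fl_add_sub_le_u_ufp hp hfl hτ₂F hτ₃F).trans (mul_le_mul_of_nonneg_left (ufp_le_abs _) hu0.le)
    have hτ₂'abs : |τ₂'| ≤ Q + u * Q := by
      have : |τ₂'| ≤ |τ₂ + τ₃| + |τ₂' - (τ₂ + τ₃)| := by
        calc |τ₂'| = |(τ₂ + τ₃) + (τ₂' - (τ₂ + τ₃))| := by ring_nf
          _ ≤ |τ₂ + τ₃| + |τ₂' - (τ₂ + τ₃)| := abs_add_le _ _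
      linarith only [this, hd₂]
    -- `res = fl(τ₁ + τ₂′)`: `|res − (τ₁ + τ₂′)| ≤ eps·ufp(τ₁ + τ₂′) ≤ eps|τ₁ + τ₂′|`
    set r := τ₁ + τ₂' with hr
    have hres_r : |fl r - r| ≤ u * ufp r := abs_fl_add_sub_le_u_ufp hp hfl hτ₁F hτ₂'F
    have hres_r' : |fl r - r| ≤ u * |r| := hres_r.trans (mul_le_mul_of_nonneg_left (ufp_le_abs r) hu0.le)
    have hr_ge : T ≤ |r| + |τ₂'| := by
      calc T = |r + -τ₂'| := by rw [hT, hr]; ring_nf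
        _ ≤ |r| + |-τ₂'| := abs_add_le _ _
        _ = |r| + |τ₂'| := by rw [abs_neg]
    have hres_ge : |r| - u * |r| ≤ |fl r| := by
      have := abs_sub_abs_le_abs_sub r (fl r)
      rw [abs_sub_comm] at this
      linarith only [this, hres_r']
    have hu1 : u ≤ 1 := u_le_one
    have hu16 : u ≤ 1 / 16 := by
      have : 4 * u * 4 ≤ 4 * u * m := mul_le_mul_of_nonneg_left hm4 (by positivity)
      linarith only [this, h4um]
    -- (4.17): `|res| ≥ (1 − 2eps)|τ₁| − n·epsσ`
    have hR1 : (1 - 2 * u) * T - n * e ≤ |fl r| := by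
      have Pa : 0 ≤ (1 - u) * (|r| + |τ₂'| - T) :=
        mul_nonneg (by linarith only [hu16]) (by linarith only [hr_ge])
      have Pb : 0 ≤ (1 - u) * ((1 + u) * Q - |τ₂'|) :=
        mul_nonneg (by linarith only [hu16]) (by linarith only [hτ₂'abs])
      have Pc : 0 ≤ u * u * Q := by positivity
      have Pd : u * A ≤ u * T := mul_le_mul_of_nonneg_left hAT hu0.le
      linarith only [hres_ge, Pa, Pb, Pc, hQle, Pd]
    -- (4.21), strict: `2ᴹ·eps(2eps·A + n(n+1)e) < (2ᴹ − 1)((1 − 2eps)T − ne)`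
    have hG : m * (2 * u * A + n * (n + 1) * e) < (m - 1) * ((1 - 2 * u) * T - n * e) := by
      have P1 : 0 ≤ ((m - 1) * (1 - 2 * u)) * (T - A) :=
        mul_nonneg (mul_nonneg (by linarith only [hm4]) (by linarith only [hu16]))
          (by linarith only [hAT])
      have P2 : 0 ≤ (m - 1 - 4 * u * m + 2 * u) * (A - m * m * e) :=
        mul_nonneg (by linarith only [hm4, h4um, hu0]) (by linarith only [hρA])
      have F3 : (n : ℚ) * (n + 2) ≤ (m - 2) * m :=
        mul_le_mul (by linarith only [hnm]) hnm (by linarith only [hn1]) (by linarith only [hm4])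
      have P3 : 0 ≤ (m * e) * ((m - 2) * m - n * (n + 2)) :=
        mul_nonneg (mul_nonneg (by linarith only [hm4]) he0.le) (by linarith only [F3])
      have P4 : 0 ≤ (m * e * m) * (1 - 4 * u * m + 2 * u) :=
        mul_nonneg (mul_nonneg (mul_nonneg (by linarith only [hm4]) he0.le) (by linarith only [hm4]))
          (by linarith only [h4um, hu0])
      have P5 : 0 < n * e := mul_pos (by linarith only [hn1]) he0
      linarith only [P1, P2, P3, P4, P5]
    -- `δ = s − (τ₁ + τ₂′)`, (4.18)–(4.20): `2|δ| ≤ eps(2eps·A + n(n+1)e)`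
    set δ := s - r with hδ
    have hδeq : δ = -(τ₂' - (τ₂ + τ₃)) + -(τ₃ - xs'.sum) := by rw [hδ, hr, hs, ← h12]; ring
    have hδabs : 2 * |δ| ≤ u * (2 * u * A + n * (n + 1) * e) := by
      have h1 : |δ| ≤ |τ₂' - (τ₂ + τ₃)| + |τ₃ - xs'.sum| := by
        rw [hδeq]
        exact (abs_add_le _ _).trans (by rw [abs_neg, abs_neg])
      have h2 : u * Q ≤ u * (u * A + n * e) := mul_le_mul_of_nonneg_left hQle hu0.le
      have h3 : ((n : ℚ) * ((n : ℚ) - 1) / 2) * (u * e) * 2 + 2 * (u * (n * e))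
          = u * (n * (n + 1) * e) := by ring
      linarith only [h1, hd₂, h2, hτ₃err', h3]
    -- KEY: `2ᴹ·2|δ| < (2ᴹ − 1)·eps·|res|`
    have hKEY : m * (2 * |δ|) < u * (m - 1) * |fl r| := by
      have Pk1 : m * (2 * |δ|) ≤ m * (u * (2 * u * A + n * (n + 1) * e)) :=
        mul_le_mul_of_nonneg_left hδabs (by linarith only [hm4])
      have Pk2 : u * (m * (2 * u * A + n * (n + 1) * e))
          < u * ((m - 1) * ((1 - 2 * u) * T - n * e)) := mul_lt_mul_of_pos_left hG hu0
      have Pk3 : u * (m - 1) * ((1 - 2 * u) * T - n * e) ≤ u * (m - 1) * |fl r| :=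
        mul_le_mul_of_nonneg_left hR1 (mul_nonneg hu0.le (by linarith only [hm4]))
      have hum : u * (m * (2 * u * A + n * (n + 1) * e))
          = m * (u * (2 * u * A + n * (n + 1) * e)) := by ring
      linarith only [Pk1, Pk2, Pk3, hum]
    have hres0 : fl r ≠ 0 := by
      intro h0
      rw [h0, abs_zero, mul_zero] at hKEY
      have : 0 ≤ m * (2 * |δ|) := mul_nonneg (by linarith only [hm4]) (by positivity)
      linarith only [hKEY, this]
    -- hence `2|δ| < eps|res|` …
    have hN : 2 * |δ| < u * |fl r| := by
      have h1 : m * (2 * |δ|) < m * (u * |fl r|) := by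
        have : 0 ≤ u * |fl r| := by positivity
        linarith only [hKEY, this]
      exact lt_of_mul_lt_mul_left h1 (by linarith only [hm4])
    -- … and `δ ∈ etaℤ`, so `|res| ≤ ½eps⁻¹eta ⟹ |δ| < eta ⟹ δ = 0`
    have hδg : OnGrid ((2 : ℚ) ^ emin) δ := by
      rw [hδeq]
      refine (((onGrid_eta_of_isFloat hτ₂'F).sub ((onGrid_eta_of_isFloat hτ₂F).add
        (onGrid_eta_of_isFloat hτ₃F))).neg).add ((onGrid_eta_of_isFloat hτ₃F).sub
        (onGrid_list_sum (fun x hx => onGrid_eta_of_isFloat (H.low x hx).1))).neg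
    have hU : |fl r| ≤ (2 : ℚ) ^ (emin + p - 1) → 2 * |δ| < (2 : ℚ) ^ emin := by
      intro hle
      have h1 : u * |fl r| ≤ (2 : ℚ) ^ (emin - 1) := by
        calc u * |fl r| ≤ u * (2 : ℚ) ^ (emin + p - 1) := mul_le_mul_of_nonneg_left hle hu0.le
          _ = (2 : ℚ) ^ (emin - 1) := by rw [hu, u_mul_two_zpow]; congr 1; ring
      have h2 : (2 : ℚ) ^ (emin - 1) < (2 : ℚ) ^ emin := zpow_lt_zpow_right₀ (by norm_num) (by omega)
      have hδ0 : δ = 0 := by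
        by_contra hne
        have := two_zpow_le_abs_of_onGrid hδg hne
        linarith only [this, h1, h2, hN, abs_nonneg δ]
      rw [hδ0, abs_zero, mul_zero]
      exact two_zpow_pos emin
    have hsr : s = r + δ := by rw [hδ]; ring
    refine ⟨?_, fun h0 => absurd h0 hres0, fun _ => ?_⟩
    · -- Lemma 2.4
      rw [hsr]
      exact isFaithfulRounding_fl_add hp hfl (fun _ => hN) hU
    · -- (4.22): `|s − res| ≤ eps·ufp(res) + |δ| < eps(1 + (1 − 2⁻ᴹ))ufp(res)`
      have hufp : ufp r ≤ ufp (fl r) := ufp_le_ufp_fl hp hfl hres0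
      have hlt2 : |fl r| < 2 * ufp (fl r) := abs_lt_two_mul_ufp hres0
      have hU0 : 0 < ufp (fl r) := ufp_pos hres0
      have h1 : |s - fl r| ≤ u * ufp (fl r) + |δ| := by
        calc |s - fl r| = |-(fl r - r) + δ| := by rw [hsr]; ring_nf
          _ ≤ |-(fl r - r)| + |δ| := abs_add_le _ _
          _ = |fl r - r| + |δ| := by rw [abs_neg]
          _ ≤ u * ufp r + |δ| := by linarith only [hres_r]
          _ ≤ u * ufp (fl r) + |δ| := by linarith only [mul_le_mul_of_nonneg_left hufp hu0.le]
      have h2 : m * |δ| < u * (m - 1) * ufp (fl r) := by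
        have : u * (m - 1) * |fl r| ≤ u * (m - 1) * (2 * ufp (fl r)) :=
          mul_le_mul_of_nonneg_left hlt2.le (mul_nonneg hu0.le (by linarith only [hm4]))
        linarith only [hKEY, this]
      have hw : m * (1 / 2 ^ (M + 1)) = 1 / 2 := by
        rw [hm, pow_succ, div_mul_eq_div_div, ← mul_div_assoc, mul_one_div_cancel (by positivity)]
      have h3 : m * (2 * u * (1 - 1 / 2 ^ (M + 1)) * ufp (fl r)) = u * (2 * m - 1) * ufp (fl r) := by
        calc m * (2 * u * (1 - 1 / 2 ^ (M + 1)) * ufp (fl r))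
            = 2 * u * ufp (fl r) * (m - m * (1 / 2 ^ (M + 1))) := by ring
          _ = 2 * u * ufp (fl r) * (m - 1 / 2) := by rw [hw]
          _ = u * (2 * m - 1) * ufp (fl r) := by ring
      have h4 : m * |s - fl r| < m * (2 * u * (1 - 1 / 2 ^ (M + 1)) * ufp (fl r)) := by
        rw [h3]
        have : m * |s - fl r| ≤ m * (u * ufp (fl r) + |δ|) :=
          mul_le_mul_of_nonneg_left h1 (by linarith only [hm4])
        linarith only [this, h2]
      exact lt_of_mul_lt_mul_left h4 (by linarith only [hm4])


/-- The inner sum `Σ p⁽ᵐ⁾ᵢ` may be evaluated in floating-point in ANY order: for every binary summation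
tree `t₃` on the leaves `p⁽ᵐ⁾` the value `τ₃ = fl(Σ p⁽ᵐ⁾ᵢ)` obeys (4.15) `|τ₃| ≤ n·epsσ` (by (4.8) and (2.22),
all quantities in the tree being multiples of `eps·epsσ ≥ eta`… in `F`), (2.20)
`|τ₃ − Σ p⁽ᵐ⁾ᵢ| ≤ ½n(n−1)eps·epsσ`, and `τ₃ = 0` for `p⁽ᵐ⁾ = 0`; hence the conclusions of Lemma 4.3 hold for
`res = fl(τ₁ + (τ₂ + τ₃))`. [cite: RumpOgitaOishi2008, Lemma 4.3 (proof, eqs. (4.15), (4.19), (2.20))] -/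
theorem faithful_of_transformSpec_tree (hfl : IsRoundNearest p emin fl) {M : ℕ} (hM : 2 ≤ M)
    (h2M : 2 * M ≤ p) {n : ℕ} (hn : 1 ≤ n) (hnM : n + 2 ≤ 2 ^ M) {s τ₁ τ₂ σ : ℚ} {xs' : List ℚ}
    (H : TransformSpec p emin fl M s n τ₁ τ₂ xs' σ) (t₃ : SumTree) (ht₃ : t₃.leaves = xs') :
    IsFaithfulRounding p emin (fl (τ₁ + fl (τ₂ + t₃.eval fl))) s ∧
      (fl (τ₁ + fl (τ₂ + t₃.eval fl)) = 0 → τ₁ = 0 ∧ τ₂ = 0 ∧ (∀ x ∈ xs', x = 0) ∧ s = 0) ∧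
      (fl (τ₁ + fl (τ₂ + t₃.eval fl)) ≠ 0 → |s - fl (τ₁ + fl (τ₂ + t₃.eval fl))| <
        2 * unitRoundoff p * (1 - 1 / 2 ^ (M + 1)) * ufp (fl (τ₁ + fl (τ₂ + t₃.eval fl)))) := by
  have hp : 1 ≤ p := by omega
  obtain ⟨k, hk, hσk⟩ := H.two_zpow
  have hleavesF : ∀ a ∈ t₃.leaves, IsFloat p emin a := fun a ha => (H.low a (ht₃ ▸ ha)).1
  have hlen : t₃.leaves.length = n := by rw [ht₃, H.length_eq]
  have hnp : t₃.leaves.length ≤ 2 ^ p := by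
    rw [hlen]
    exact le_trans (by omega) (Nat.pow_le_pow_right (by norm_num) (by omega : M ≤ p))
  -- for `σ > ½eps⁻¹eta`: `σ = 2^k` with `k ≥ emin + p`, and `max |p⁽ᵐ⁾ᵢ| ≤ epsσ = 2^(k−p)`, `k − p ≥ emin`
  have hj : (2 : ℚ) ^ (emin + p - 1) < σ → emin ≤ k - p := by
    intro hσ
    by_contra hlt
    have : (2 : ℚ) ^ k ≤ (2 : ℚ) ^ (emin + p - 1) := zpow_le_zpow_right₀ (by norm_num) (by omega)
    rw [← hσk] at this
    exact absurd hσ (not_lt.mpr this)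
  have huσ : unitRoundoff p * σ = (2 : ℚ) ^ (k - p) := by rw [hσk, u_mul_two_zpow]
  have hleaves : ∀ a ∈ t₃.leaves, IsFloat p emin a ∧ |a| ≤ (2 : ℚ) ^ (k - p) :=
    fun a ha => ⟨hleavesF a ha, huσ ▸ (H.low a (ht₃ ▸ ha)).2⟩
  refine faithful_of_transformSpec hfl hM h2M hn hnM H (isFloat_eval hfl t₃ hleavesF) ?_ ?_ ?_
  · intro hσ
    have := abs_eval_le_length_mul hp hfl (hj hσ) t₃ hleaves hnp
    rw [hlen, ← huσ] at this
    exact this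
  · intro hσ
    have := abs_eval_sub_exact_le hp hfl (hj hσ) t₃ hleaves hnp
    rw [hlen, exact_eq_leaves_sum, ht₃, ← huσ] at this
    exact this
  · intro hz
    exact eval_eq_zero_of_leaves hfl t₃ (fun a ha => hz a (ht₃ ▸ ha))

/-- A nonempty vector is the leaf list of the left comb on its entries, and `fl(Σ pᵢ)` by recursive
summation is the evaluation of that tree. [cite: RumpOgitaOishi2008, Algorithm 4.5] -/
theorem exists_tree_flSum (fl : ℚ → ℚ) : ∀ {xs : List ℚ}, xs ≠ [] →
    ∃ t : SumTree, t.leaves = xs ∧ flSum fl xs = t.eval fl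
  | [], h => absurd rfl h
  | x :: xs, _ => ⟨accTree (SumTree.leaf x) xs, by rw [leaves_accTree]; rfl, flSum_cons_eq_eval fl x xs⟩

/-- `fl(Σ pᵢ) = 0` for the zero vector. [cite: RumpOgitaOishi2008, Algorithm 4.5] -/
theorem flSum_eq_zero (hfl : IsRoundNearest p emin fl) {xs : List ℚ} (hz : ∀ x ∈ xs, x = 0) :
    flSum fl xs = 0 := by
  by_cases hnil : xs = []
  · rw [hnil]; rfl
  · obtain ⟨t, ht, hft⟩ := exists_tree_flSum fl hnil
    rw [hft]
    exact eval_eq_zero_of_leaves hfl t (fun a ha => hz a (ht ▸ ha))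

/-- `M = ⌈log₂(n + 2)⌉ ≥ 2` for `n ≥ 1`. [cite: RumpOgitaOishi2008, Lemma 4.2 (M)] -/
theorem two_le_clog_length_add_two {xs : List ℚ} (hnil : xs ≠ []) : 2 ≤ Nat.clog 2 (xs.length + 2) := by
  have hn : 1 ≤ xs.length := by
    cases xs with
    | nil => exact absurd rfl hnil
    | cons _ _ => simp
  by_contra h
  have : Nat.clog 2 (xs.length + 2) ≤ 1 := by omega
  rw [Nat.clog_le_iff_le_pow (by norm_num)] at this
  omega

/-- `M = ⌈log₂(n + 2)⌉ ≥ 1`, so the hypothesis `2²ᴹeps ≤ 1` forces `p ≥ 2`. [cite: RumpOgitaOishi2008, Lemma 4.2 (M)] -/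
theorem one_le_clog_length_add_two (xs : List ℚ) : 1 ≤ Nat.clog 2 (xs.length + 2) := by
  by_contra h
  have : Nat.clog 2 (xs.length + 2) ≤ 0 := by omega
  rw [Nat.clog_le_iff_le_pow (by norm_num), pow_zero] at this
  omega

/-! ### §4: Algorithm 4.5 `AccSum` — Lemma 4.3, Proposition 4.6, Corollary 4.7 -/

/-- On the zero vector (and on the empty one) `AccSum` returns `res = 0 = s`.
[cite: RumpOgitaOishi2008, Algorithm 4.1 ("if μ = 0") / Algorithm 4.5] -/
theorem accSum_of_maxAbs_eq_zero (hfl : IsRoundNearest p emin fl) {xs : List ℚ} (h : maxAbs xs = 0) :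
    accSum fl p emin xs = 0 ∧ xs.sum = 0 := by
  have hz := maxAbs_eq_zero_iff.mp h
  refine ⟨?_, List.sum_eq_zero hz⟩
  rw [accSum, transform_of_maxAbs_eq_zero fl p emin h]
  simp only [flSum_eq_zero hfl hz, zero_add, fl_eq_self hfl (isFloat_zero p emin)]

/-- **LEMMA 4.3** (for Algorithm 4.1 `Transform` and `res` as computed by Algorithm 4.5 `AccSum`). Let `p`
be a nonzero vector of `n` floating-point numbers, `M = ⌈log₂(n + 2)⌉`, `2²ᴹeps ≤ 1`. Then
`res = fl(τ₁ + (τ₂ + Σ p⁽ᵐ⁾ᵢ))` is a faithful rounding of `s = Σ pᵢ`; `res = 0 ⟹ τ₁ = τ₂ = 0, p⁽ᵐ⁾ = 0, s = 0`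
(eq. (4.23)); and for `res ≠ 0` (4.11) `|s − res| < 2eps(1 − 2^(−M−1))ufp(res)` (for `res = 0` one has
`s = res` exactly, and (4.11) as printed would read `0 < 0`). [cite: RumpOgitaOishi2008, Lemma 4.3 eqs. (4.11), (4.23)] -/
theorem accSum_spec_of_maxAbs_ne_zero (hfl : IsRoundNearest p emin fl) {xs : List ℚ}
    (hxs : ∀ x ∈ xs, IsFloat p emin x) (hne : maxAbs xs ≠ 0)
    (h2M : 2 * Nat.clog 2 (xs.length + 2) ≤ p) :
    IsFaithfulRounding p emin (accSum fl p emin xs) xs.sum ∧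
      (accSum fl p emin xs = 0 → (transform fl p emin xs).1 = 0 ∧ (transform fl p emin xs).2.1 = 0 ∧
        (∀ x ∈ (transform fl p emin xs).2.2.1, x = 0) ∧ xs.sum = 0) ∧
      (accSum fl p emin xs ≠ 0 → |xs.sum - accSum fl p emin xs| <
        2 * unitRoundoff p * (1 - 1 / 2 ^ (Nat.clog 2 (xs.length + 2) + 1)) *
          ufp (accSum fl p emin xs)) := by
  have hnil : xs ≠ [] := by rintro rfl; exact hne rfl
  have hM : 2 ≤ Nat.clog 2 (xs.length + 2) := two_le_clog_length_add_two hnil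
  have hp : 1 ≤ p := by omega
  have hn : 1 ≤ xs.length := by
    cases xs with
    | nil => exact absurd rfl hnil
    | cons _ _ => simp
  have hnM : xs.length + 2 ≤ 2 ^ Nat.clog 2 (xs.length + 2) := Nat.le_pow_clog (by norm_num) _
  have H := transform_spec hp hfl hxs hne h2M
  have hnil' : (transform fl p emin xs).2.2.1 ≠ [] := by
    intro h
    have h1 := H.length_eq
    rw [h, List.length_nil] at h1
    omega
  obtain ⟨t₃, ht₃, hft⟩ := exists_tree_flSum fl hnil'
  have := faithful_of_transformSpec_tree hfl hM h2M hn hnM H t₃ ht₃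
  rw [accSum, hft]
  exact this

/-- **PROPOSITION 4.6.** Let `p` be a vector of `n` floating-point numbers, `M = ⌈log₂(n + 2)⌉`,
`2²ᴹeps ≤ 1`. Then the result `res` of Algorithm 4.5 (`AccSum`) is a faithful rounding of `s := Σ pᵢ`
(Definition 2.3; for the zero or empty vector `res = 0 = s`).
[cite: RumpOgitaOishi2008, Proposition 4.6] -/
theorem isFaithfulRounding_accSum (hfl : IsRoundNearest p emin fl) {xs : List ℚ}
    (hxs : ∀ x ∈ xs, IsFloat p emin x) (h2M : 2 * Nat.clog 2 (xs.length + 2) ≤ p) :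
    IsFaithfulRounding p emin (accSum fl p emin xs) xs.sum := by
  by_cases hμ : maxAbs xs = 0
  · obtain ⟨h1, h2⟩ := accSum_of_maxAbs_eq_zero hfl hμ (p := p)
    rw [h1, h2]
    have := isFaithfulRounding_fl hfl (0 : ℚ)
    rwa [fl_eq_self hfl (isFloat_zero p emin)] at this
  · exact (accSum_spec_of_maxAbs_ne_zero hfl hxs hμ h2M).1

/-- **PROPOSITION 4.6** in the vocabulary of Boldo–Jeannerod–Melquiond–Muller: `AccSum(p)` is a
faithful rounding (`IsFaithful`: it is `RD(s)` or `RU(s)`) of `s = Σ pᵢ`.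
[cite: RumpOgitaOishi2008, Proposition 4.6] -/
theorem isFaithful_accSum (hfl : IsRoundNearest p emin fl) {xs : List ℚ}
    (hxs : ∀ x ∈ xs, IsFloat p emin x) (h2M : 2 * Nat.clog 2 (xs.length + 2) ≤ p) :
    IsFaithful p emin xs.sum (accSum fl p emin xs) :=
  isFaithfulRounding_iff_isFaithful.mp (isFaithfulRounding_accSum hfl hxs h2M)

/-- **LEMMA 4.3, eq. (4.11)** for `AccSum`: if `res ≠ 0` then `|s − res| < 2eps(1 − 2^(−M−1))ufp(res)` —
better than faithful by a factor of nearly two near powers of two.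
[cite: RumpOgitaOishi2008, Lemma 4.3 eq. (4.11)] -/
theorem abs_sum_sub_accSum_lt (hfl : IsRoundNearest p emin fl) {xs : List ℚ}
    (hxs : ∀ x ∈ xs, IsFloat p emin x) (h2M : 2 * Nat.clog 2 (xs.length + 2) ≤ p)
    (hres : accSum fl p emin xs ≠ 0) :
    |xs.sum - accSum fl p emin xs| <
      2 * unitRoundoff p * (1 - 1 / 2 ^ (Nat.clog 2 (xs.length + 2) + 1)) * ufp (accSum fl p emin xs) := by
  by_cases hμ : maxAbs xs = 0
  · exact absurd (accSum_of_maxAbs_eq_zero hfl hμ (p := p)).1 hres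
  · exact (accSum_spec_of_maxAbs_ne_zero hfl hxs hμ h2M).2.2 hres

/-- **COROLLARY 4.7 (i):** if `s = Σ pᵢ` is a floating-point number then `res = s` (faithful rounding of
a float is the float). [cite: RumpOgitaOishi2008, Corollary 4.7] -/
theorem accSum_eq_sum_of_isFloat_sum (hfl : IsRoundNearest p emin fl) {xs : List ℚ}
    (hxs : ∀ x ∈ xs, IsFloat p emin x) (h2M : 2 * Nat.clog 2 (xs.length + 2) ≤ p)
    (hs : IsFloat p emin xs.sum) : accSum fl p emin xs = xs.sum :=
  (isFaithfulRounding_accSum hfl hxs h2M).eq_of_isFloat hs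

/-- **COROLLARY 4.7 (ii):** `res = 0` if and only if `s = 0` (and then `τ₁ = τ₂ = 0`, `p⁽ᵐ⁾ = 0`,
`accSum_spec_of_maxAbs_ne_zero`). [cite: RumpOgitaOishi2008, Corollary 4.7 / Lemma 4.3 eq. (4.23)] -/
theorem accSum_eq_zero_iff (hfl : IsRoundNearest p emin fl) {xs : List ℚ}
    (hxs : ∀ x ∈ xs, IsFloat p emin x) (h2M : 2 * Nat.clog 2 (xs.length + 2) ≤ p) :
    accSum fl p emin xs = 0 ↔ xs.sum = 0 := by
  constructor
  · intro h
    by_cases hμ : maxAbs xs = 0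
    · exact (accSum_of_maxAbs_eq_zero hfl hμ (p := p)).2
    · exact ((accSum_spec_of_maxAbs_ne_zero hfl hxs hμ h2M).2.1 h).2.2.2
  · intro hs
    have h0 : IsFloat p emin xs.sum := by rw [hs]; exact isFloat_zero p emin
    rw [accSum_eq_sum_of_isFloat_sum hfl hxs h2M h0, hs]

/-- **COROLLARY 4.7 (iii):** if `res` is in the underflow range, `|res| ≤ ½eps⁻¹eta`, then `res = s`:
the neighbours of `res` are `res ± eta` (Lemma 2.2), faithfulness puts `s` strictly between them, and
`s − res ∈ etaℤ`. [cite: RumpOgitaOishi2008, Corollary 4.7] -/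
theorem accSum_eq_sum_of_abs_le (hfl : IsRoundNearest p emin fl) {xs : List ℚ}
    (hxs : ∀ x ∈ xs, IsFloat p emin x) (h2M : 2 * Nat.clog 2 (xs.length + 2) ≤ p)
    (hU : |accSum fl p emin xs| ≤ (2 : ℚ) ^ (emin + p - 1)) : accSum fl p emin xs = xs.sum := by
  have hp : 1 ≤ p := le_trans (one_le_clog_length_add_two xs) (by omega)
  have hF := isFaithfulRounding_accSum hfl hxs h2M
  have hresF : IsFloat p emin (accSum fl p emin xs) := hF.isFloat
  obtain ⟨⟨hpF, hplt, -⟩, ⟨hsF, hslt, -⟩⟩ := isPred_sub_eta_and_isSucc_add_eta hp hresF hU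
  have h1 : accSum fl p emin xs - (2 : ℚ) ^ emin < xs.sum := hF.2.1 _ hpF hplt
  have h2 : xs.sum < accSum fl p emin xs + (2 : ℚ) ^ emin := hF.2.2 _ hsF hslt
  have hg : OnGrid ((2 : ℚ) ^ emin) (xs.sum - accSum fl p emin xs) :=
    (onGrid_list_sum (fun x hx => onGrid_eta_of_isFloat (hxs x hx))).sub (onGrid_eta_of_isFloat hresF)
  by_contra hne
  have hne' : xs.sum - accSum fl p emin xs ≠ 0 := sub_ne_zero.mpr (Ne.symm hne)
  have h3 := two_zpow_le_abs_of_onGrid hg hne'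
  have h4 : |xs.sum - accSum fl p emin xs| < (2 : ℚ) ^ emin := abs_sub_lt_iff.mpr ⟨by linarith, by linarith⟩
  linarith

/-- **COROLLARY 4.7 (iv):** `sign(res) = sign(s)`. [cite: RumpOgitaOishi2008, Corollary 4.7] -/
theorem accSum_pos_iff_and_neg_iff (hfl : IsRoundNearest p emin fl) {xs : List ℚ}
    (hxs : ∀ x ∈ xs, IsFloat p emin x) (h2M : 2 * Nat.clog 2 (xs.length + 2) ≤ p) :
    (0 < accSum fl p emin xs ↔ 0 < xs.sum) ∧ (accSum fl p emin xs < 0 ↔ xs.sum < 0) := by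
  have hF := isFaithfulRounding_accSum hfl hxs h2M
  -- `0 ≤ s → 0 ≤ res`, `s ≤ 0 → res ≤ 0`
  obtain ⟨h1, h2, -⟩ := hF.sign
  have hz := accSum_eq_zero_iff hfl hxs h2M
  refine ⟨⟨fun h => ?_, fun h => ?_⟩, ⟨fun h => ?_, fun h => ?_⟩⟩
  · by_contra hle
    exact absurd (h2 (not_lt.mp hle)) (not_le.mpr h)
  · exact lt_of_le_of_ne (h1 h.le) (fun h0 => absurd (hz.mp h0.symm) h.ne')
  · by_contra hle
    exact absurd (h1 (not_lt.mp hle)) (not_le.mpr h)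
  · exact lt_of_le_of_ne (h2 h.le) (fun h0 => absurd (hz.mp h0) h.ne)


/-- **LEMMA 4.3, eqs. (4.9), (4.10), (4.12)** (and Lemma 4.2's (4.2)–(4.5) regrouped): for the results
`[τ₁, τ₂, p′, σ]` of `Transform`, `s = τ₁ + τ₂ + Σ p′ᵢ` and `max |p′ᵢ| ≤ epsσ` (4.9); `fl(τ₁ + τ₂) = τ₁`,
`τ₁, τ₂ ∈ epsσℤ` and `|τ₂| ≤ eps·ufp(τ₁)` (4.10); and `σ > ½eps⁻¹eta ⟹ ufp(τ₁) ≥ 2²ᴹepsσ` (4.12).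
[cite: RumpOgitaOishi2008, Lemma 4.3 eqs. (4.9), (4.10), (4.12)] -/
theorem TransformSpec.eqs (hp : 1 ≤ p) (hfl : IsRoundNearest p emin fl) {M : ℕ} {s : ℚ} {n : ℕ}
    {τ₁ τ₂ σ : ℚ} {xs' : List ℚ} (H : TransformSpec p emin fl M s n τ₁ τ₂ xs' σ) :
    s = τ₁ + τ₂ + xs'.sum ∧ (∀ x ∈ xs', |x| ≤ unitRoundoff p * σ) ∧ fl (τ₁ + τ₂) = τ₁ ∧
      OnGrid (unitRoundoff p * σ) τ₁ ∧ OnGrid (unitRoundoff p * σ) τ₂ ∧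
      |τ₂| ≤ unitRoundoff p * ufp τ₁ ∧
      ((2 : ℚ) ^ (emin + p - 1) < σ → 2 ^ (2 * M) * unitRoundoff p * σ ≤ ufp τ₁) := by
  obtain ⟨k, hk, hσk⟩ := H.two_zpow
  obtain ⟨t, τ, htF, hτF, htg, hτg, hτlt, hs, h12, h1, hτ₂le⟩ := H.last
  have hτ₁g : OnGrid (unitRoundoff p * σ) τ₁ := by
    rw [hσk] at htg hτg ⊢
    rw [h1]
    exact (onGrid_fl_add hp hfl htg hτg).1
  have hτ₂g : OnGrid (unitRoundoff p * σ) τ₂ := by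
    have : τ₂ = t + τ - τ₁ := by rw [← h12]; ring
    rw [this]
    exact (htg.add hτg).sub hτ₁g
  refine ⟨by rw [hs, ← h12], fun x hx => (H.low x hx).2, by rw [h12, ← h1], hτ₁g, hτ₂g, hτ₂le,
    fun hσ => ?_⟩
  have h := H.exit hσ
  rw [hσk, two_pow_mul_u_mul_two_zpow] at h ⊢
  exact two_zpow_le_ufp h

end Literature.ComputerArithmetic.RumpOgitaOishi2008
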